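import Literature.NumberTheory.Automorphic.ShimuraCurveRibetTakahashiDenominatorProofs
import Literature.NumberTheory.Automorphic.ShimuraCurveRibetTakahashiAssemblyProofs
import Literature.NumberTheory.DiophantineGeometry.PastenValuationProductsProofs
import Literature.NumberTheory.DiophantineGeometry.ConductorRadicalProofs
import Literature.NumberTheory.EllipticCurves.SzpiroFreyConductorProofs
import Literature.NumberTheory.EllipticCurves.SzpiroOfAbcProofs
import Literature.NumberTheory.EllipticCurves.ComplexMultiplicationLFunctionIsogenyHoldsProofs
import Literature.NumberTheory.EllipticCurves.PastenValuationProduct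
import HarnessLib

/-!
# Pasten 2024, §6.6–6.9 performed in the tree: the image bound (Lemma 6.14), switching primes
# (Lemmas 6.15, 6.16), the uniform cokernel bound (Thm. 6.17), and Thm. 6.1 (b) from the finer
# printed inputs

Topic `NumberTheory/Automorphic`; a proofs-only companion (theorems only: no definition, no named
fact, nothing restated; D-0026) of `ShimuraCurveRibetTakahashi.lean`, for its named fact
`Literature.NumberTheory.Automorphic.PastenShimura2024_thm_6_1_b` (H. Pasten, *Shimura curves and
the abc conjecture*, J. Number Theory 254 (2024) = arXiv:1705.09251, Thm. 6.1 (b) p. 20). The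
earlier companion `ShimuraCurveRibetTakahashiDenominatorProofs.lean` performed the telescoping of
§6.9 and reduced the fact to one packaged hypothesis `h613b` = "Prop. 6.13 with the bounds
`i_p ∣ κ₁` (Lemma 6.14) and `j_r ∣ κ₂` (Thm. 6.17) attached". This file opens that package and
PROVES, in the tree, the part of it that is Pasten's own §6: Lemma 6.14 (from the Eisenstein
property and Lemma 6.7), Lemma 6.15, Lemma 6.16 and Thm. 6.17 — in the generality in which the
printed proof runs (`E` semistable away from a finite set `S`, the "Fermat input" of Lemmas
6.11/6.12 as a hypothesis, `M` with `≠ 1` multiplicative primes) — so that what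
`PastenShimura2024_thm_6_1_b_holds` still needs is exactly the list of EXTERNAL theorems quoted in
§6, each as one hypothesis in the shape in which the printed proof invokes it:

* (`h613`) Prop. 6.13 = Ribet–Takahashi 1997, Thm. 2 (p. 23): for `D = dpr`,
  `δ_{d,prM} · i_p(d,prM)² · j_r(dpr,M)² = δ_{dpr,M} · c_p(A_{d,prM}) · c_r(A_{dpr,M})`, over the
  tree's idiom (`ShimuraCurveRibetTakahashi.lean`, module docstring): `δ_{D,M} = deg P` for a
  class-minimal datum `P` (`IsMinimalFor`) on an `X : ShimuraCurveData D M`, `A_{D,M}` = the curve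
  `W'` it parametrises, `c_p(A) = v_p(Δ_A)` (§6.4 p. 22: "`Φ_p(A)` is a cyclic group of order
  `c_p(A) := v_p(Δ_A)`"), and — the tree having no Néron models — the orders
  `i_p(D,M) = # image`, `j_p(D,M) = # cokernel` of `q_{D,M,p,*} : Φ_p(J₀^D(M)) → Φ_p(A_{D,M})`
  (§6.6 p. 23) as two FUNCTIONS `cI cJ` of the datum and the prime (hypotheses `hI`, `hJ`: they are
  positive), the same functions in every instance (this is what Lemmas 6.15/6.16 use: one cokernel
  order occurs in two instances of Prop. 6.13);
* (`hJc`) "by definition `j_p(D,M)` divides `c_p(A_{D,M}) = #Φ_p(A_{D,M})`" (proof of Lemma 6.15,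
  p. 24), `p ∣ D`;
* (`hEis` + `h67` ⟹ Lemma 6.14, or `h614` directly) the Eisenstein property of `Φ_p(J₀^D(M))`
  (Ribet; proof of Lemma 6.14 p. 23: "`i_p(J₀^D(M), χ_{D,M})` divides `r + 1 − a_r(A_{D,M})` for
  every prime `r ∤ N`", `p ∥ M`) and Lemma 6.7 p. 22 (Mazur, Ribet, Faltings, Chebotarev: an integer
  `β_S(ℓ)`, `= 1` for `ℓ > 163`, with infinitely many `r`, `a_r(A) ≢ r + 1 mod ℓ^{β_S(ℓ)}`, for
  every `A` semistable away from `S`);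
* (`h68`) Lemma 6.8 p. 22 (Mazur–Kenku), verbatim the hypothesis of the sibling files, available
  in the tree from the named fact `PastenShimura2024_lemma_6_8` (`lemma_6_8_factorization_form`) or
  from `mazurKenku_exists_cyclic_isogeny` (`PastenShimura2024_lemma_6_8_of_mazurKenku'`);
* (`h610`) Lemma 6.10 p. 23 (Darmon–Granville) in the form its proof ends with ("for fixed `S` and
  `L`, there are only finitely many elliptic curves `E` over `ℚ` with `Δ_E = n · k^L` for some
  integers `n, k` with `n` an `S`-unit"), recorded as finiteness of the set of their `|Δ_min|`;
* (`h611`) Lemma 6.11 p. 23 (Mazur Thm. 4, Ribet's level-lowering, Wiles: `Δ_E` of a semistable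
  `E` is not a perfect `ℓ`-th power, `ℓ ≥ 11`), in the rendering of the summit-side
  `fermatInputKnown_of_inputs` (`|Δ_min| ≠ k^ℓ`, `k ≥ 2`);
* (`h612`) Lemma 6.12 p. 23 (Wiles, Ribet 1997, Darmon–Merel: for `(a,b,c) ≠ (1,1,2)` the odd part
  of `Δ_E` of the Frey–Hellegouarch curve is not a perfect `ℓ`-th power, `ℓ ≥ 3`);
* (`hP`) the Jacquet–Langlands existence fact `nonempty_shimuraParametrizationData` (§2 p. 12) and
  (`h0`) the `D = 1` bridge of the two renderings of `δ_{1,N}` (as in the sibling files).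

What is proved (sorry-free; `hX = nonempty_shimuraCurveData_holds` is a theorem of the tree):

* flat arithmetic of valuations: `factorization_le_of_two_identities` (Lemma 6.15, `p ≠ r`),
  `factorization_le_of_four_identities` (Lemma 6.16: (EqEXP1) = (EqEXP2)),
  `dvd_prod_pow_of_factorization_le` ("`v_ℓ(j) ≤ α(ℓ)`, `α` supported on `ℓ ≤ 163` ⟹ `j ∣ κ`"),
  `exists_eq_mul_pow_of_dvd_factorization` (perfect powers from factorisations);
* `IsAdmissibleFactorization.insert_two_primes` (`N = D·rtm ⟹ N = (Drt)·m` admissible),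
  `not_sq_dvd_conductorNorm_of_isFreyHellegouarch` (Frey–Hellegouarch curves are semistable at odd
  primes; Pasten §3), `factorization_minimalDiscriminantNorm_pos_of_dvd` (`p ∣ N ⟹ v_p(Δ) ≥ 1`);
* `PastenShimura2024_lemma_6_15` — `v_ℓ(j_p(D,M)) ≤ v_ℓ(c_r(E)) + v_ℓ(κ_S) + 3 log_ℓ 163` for
  `p, r ∣ D`;
* `PastenShimura2024_lemma_6_16` — `v_ℓ(j_p(D,M)) ≤ v_ℓ(c_r(E)) + 2 v_ℓ(κ_S) + 4 log_ℓ 163` for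
  `p ∣ D`, `r ∣ M` multiplicative, `M` with a second multiplicative prime;
* `PastenShimura2024_thm_6_17'` — **the uniform cokernel bound in the generality of its proof**:
  an integer `κ₂ ≥ 1` supported on primes `≤ 163` (depending on `S`, `κ_S` and the exceptional
  sets of Lemma 6.10 only) with `j_p(D,M) ∣ κ₂` for every `E` semistable away from `S` satisfying
  the Fermat input ("for every prime `ℓ ≥ 11` some multiplicative prime `r` has `ℓ ∤ c_r(E)`") and
  every admissible `N = DM` whose `M` does not have exactly one multiplicative prime, `p ∣ D`
  (the printed cases (i)/(ii) are `S = ∅`/`{2}` with Lemmas 6.11/6.12 supplying the Fermat input: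
  `fermatInput_of_isSemistable`, `fermatInput_of_isFreyHellegouarch`);
* `PastenShimura2024_lemma_6_14` — `i_p(D,M) ∣ κ_S` (`κ_S ≥ 1` supported on primes `≤ 163`) for
  `N` squarefree away from `S` and `p ∥ M`, from `hEis` and `h67` (with the tree's isogeny
  invariance of `L(E,s)`, `LFunction_eq_of_isIsogenous_holds`, to pass from `A_{D,M}` to `E`);
* `PastenShimura2024_thm_6_1_b_of_ribetTakahashi_inputs` — **Thm. 6.1 (b) from `h613`, `hJc`,
  `h614`, `h68`, `h610`, `h611`, `h612`, `hP`, `h0`** (the landed telescoping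
  `PastenShimura2024_thm_6_1_b_of_prop_6_13_bounded_of_lemma_6_8` fed with Thm. 6.17' at
  `S = {2}`), and `PastenShimura2024_thm_6_1_b_of_ribetTakahashi_eisenstein_mazurKenku` — the same
  over the tree's facts (`h614` from `hEis`/`h67`, `h68` from `mazurKenku_exists_cyclic_isogeny`);
* `twoPrimeStep_of_ribetTakahashi_inputs`, `denominator_dvd_pow_of_twoPrimeStep`,
  `PastenShimura2024_thm_6_1_b'` — the bounded two-prime step (EqSequentially) and the telescoping
  for an arbitrary class stable under `M ↦ prM`, and "Thm. 6.1 (b′)": the conclusion of Thm. 6.1 (b)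
  for every `E` semistable away from `S` with the Fermat input and `M` without exactly one
  multiplicative prime (Pasten's proof run in that generality; the form in which the summit-side
  line `jl-zero-cycle-height` of `Summits/ABC` consumes the theorem on its residual class);
* (second instalment, §V) `PastenShimura2024_thm_6_17_of_witnesses` (Thm. 6.17 with its Diophantine
  input isolated per curve and per prime), `PastenShimura2024_thm_6_1_b_of_ribetTakahashi_mestreOesterle`
  and `PastenShimura2024_thm_6_1_b_of_ribetTakahashi_treeFacts` — for semistable `E` the inputs of
  Lemmas 6.10/6.11 are the tree's named fact `mestreOesterle1989_thm_1`, so the Diophantine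
  hypotheses shrink to Lemma 6.12 and Lemma 6.10 at `S ∋ 2`, `L = 8`.

## References

* H. Pasten, *Shimura curves and the abc conjecture*, J. Number Theory 254 (2024) 214–335 =
  arXiv:1705.09251 (held text, pp. 20–25 read): §6.3 Lemma 6.7 p. 22, §6.4 and Lemma 6.8 p. 22,
  §6.5 Lemmas 6.10–6.12 p. 23, §6.6 Prop. 6.13 and Lemma 6.14 p. 23, §6.7 Lemmas 6.15–6.16 p. 24,
  §6.8 Thm. 6.17 p. 24, §6.9 p. 25. [PastenShimura2024]
* K. A. Ribet, S. Takahashi, *Parametrizations of elliptic curves by Shimura curves and by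
  classical modular curves*, PNAS 94 (1997) 11110–11114, Thm. 2. [RibetTakahashi1997]
* B. Mazur, Invent. Math. 44 (1978), Thm. 1 [Mazur1978]; M. A. Kenku, J. Number Theory 15 (1982)
  [Kenku1982].

## Mathlib / tree search

Tree: `IsAdmissibleFactorization.erase_two_primes`, `IsAdmissibleFactorization.dvd_and_not_sq_dvd`,
`ShimuraParametrizationData.exists_isMinimalFor_of_nonempty`, `lemma_6_8_factorization_form`,
`PastenShimura2024_thm_6_1_b_of_prop_6_13_bounded_of_lemma_6_8`, `nonempty_shimuraCurveData_holds`,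
`WeierstrassCurve.isSemistable_iff_squarefree_conductorNorm`, `radical_conductorNorm_eq_holds`,
`minimalDiscriminantNorm_pos_holds`, `conductorNorm_freyCurve_dvd_holds`, `conductorNorm_smul_rat`,
`LFunction_eq_of_isIsogenous_holds`. No component group, Néron model or `J₀^D(M)` exists in
Mathlib or the tree (`lean search 'componentGroup|NeronModel|Phi_p'`), whence the functions
`cI cJ`.
-/

noncomputable section

open scoped MatrixGroups ModularForm

namespace Literature.NumberTheory.Automorphic

open Literature.NumberTheory.EllipticCurves (freyCurve isElliptic_freyCurve
  conductorNorm_freyCurve_dvd_holds mazurKenku_exists_cyclic_isogeny LFunction_eq_of_isIsogenous_holds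
  mestreOesterle1989_thm_1)
open Literature.NumberTheory.EllipticCurves.ModularForms (ModularParametrizationData IsNewformOf
  PastenShimura2024_lemma_6_8 PastenShimura2024_lemma_6_8_of_mazurKenku')

/-! ## I. Flat arithmetic of valuations (§6.7 with the geometry stripped off) -/

/-- `v_ℓ(a b) = v_ℓ(a) + v_ℓ(b)` for `a, b ≠ 0`. [folklore] -/
theorem factorization_mul_apply {a b : ℕ} (ha : a ≠ 0) (hb : b ≠ 0) (ℓ : ℕ) :
    (a * b).factorization ℓ = a.factorization ℓ + b.factorization ℓ := by
  rw [Nat.factorization_mul ha hb, Finsupp.add_apply]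

/-- `v_ℓ(a ^ k) = k v_ℓ(a)`. [folklore] -/
theorem factorization_pow_apply (a k ℓ : ℕ) : (a ^ k).factorization ℓ = k * a.factorization ℓ := by
  rw [Nat.factorization_pow, Finsupp.smul_apply, smul_eq_mul]

/-- A positive integer `a ≤ T` has `v_ℓ(a) ≤ log_ℓ T` (so `v_ℓ(a) = 0` for `ℓ > T`): the numbers of
"multiplicative height at most `163`" of Lemma 6.8 have bounded valuations, vanishing at primes
`ℓ > 163`. [folklore] -/
theorem factorization_le_log_of_le {a T : ℕ} (ha : 0 < a) (haT : a ≤ T) (ℓ : ℕ) :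
    a.factorization ℓ ≤ Nat.log ℓ T := by
  by_cases hℓ : ℓ.Prime
  · exact Nat.le_log_of_pow_le hℓ.one_lt ((Nat.le_of_dvd ha (Nat.ordProj_dvd a ℓ)).trans haT)
  · simp [Nat.factorization_eq_zero_of_not_prime _ hℓ]

/-- `v_ℓ(j) ≤ v_ℓ(c)` when `j ∣ c ≠ 0`. [folklore] -/
theorem factorization_le_of_dvd_of_ne_zero {j c : ℕ} (hc : c ≠ 0) (h : j ∣ c) (ℓ : ℕ) :
    j.factorization ℓ ≤ c.factorization ℓ := by
  have hj : j ≠ 0 := by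
    rintro rfl
    exact hc (zero_dvd_iff.mp h)
  exact (Nat.factorization_le_iff_dvd hj hc).mpr h ℓ

/-- **Lemma 6.8 in valuations.** If `c_A · b = a · c_E` with `1 ≤ a, b ≤ 163` and `c_E ≥ 1`, then
`c_A ≥ 1` and `|v_ℓ(c_A) − v_ℓ(c_E)| ≤ log_ℓ 163` for every `ℓ` (Lemma 6.8: "`c_p(A)/c_p(B)` is a
rational number whose multiplicative height is at most `163`. In particular, it is supported on
primes `≤ 163`"). [cite: PastenShimura2024, Lemma 6.8 p. 22] -/
theorem factorization_dist_le_log_of_mul_eq_mul {cA cE a b : ℕ} (ha : 0 < a) (ha' : a ≤ 163)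
    (hb : 0 < b) (hb' : b ≤ 163) (hcE : 0 < cE) (h : cA * b = a * cE) (ℓ : ℕ) :
    0 < cA ∧ cA.factorization ℓ ≤ cE.factorization ℓ + Nat.log ℓ 163 ∧
      cE.factorization ℓ ≤ cA.factorization ℓ + Nat.log ℓ 163 := by
  have hcA : 0 < cA := by
    rcases Nat.eq_zero_or_pos cA with h0 | h0
    · rw [h0, zero_mul] at h
      exact absurd h.symm (Nat.mul_ne_zero ha.ne' hcE.ne')
    · exact h0
  have hv := congrArg (fun n : ℕ => n.factorization ℓ) h
  simp only [factorization_mul_apply hcA.ne' hb.ne', factorization_mul_apply ha.ne' hcE.ne'] at hv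
  have h1 := factorization_le_log_of_le ha ha' ℓ
  have h2 := factorization_le_log_of_le hb hb' ℓ
  exact ⟨hcA, by omega, by omega⟩

/-- **Lemma 6.15, case `p = r` (flat form).** If `j ∣ c_p(A)` ("by definition `j_p(D,M)` divides
`c_p(A_{D,M}) = #Φ_p(A_{D,M})`") and `c_p(A) · b = a · c_p(E)` with `1 ≤ a, b ≤ 163` (Lemma 6.8),
`c_p(E) ≥ 1`, then `v_ℓ(j) ≤ v_ℓ(c_p(E)) + log_ℓ 163` for every `ℓ`.
[cite: PastenShimura2024, Lemma 6.15 p. 24 (proof, case p = r)] -/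
theorem factorization_le_of_dvd_of_mul_eq_mul {j cA cE a b : ℕ} (hj : j ∣ cA) (ha : 0 < a)
    (ha' : a ≤ 163) (hb : 0 < b) (hb' : b ≤ 163) (hcE : 0 < cE) (h : cA * b = a * cE) (ℓ : ℕ) :
    j.factorization ℓ ≤ cE.factorization ℓ + Nat.log ℓ 163 := by
  obtain ⟨hcA, h1, -⟩ := factorization_dist_le_log_of_mul_eq_mul ha ha' hb hb' hcE h ℓ
  exact (factorization_le_of_dvd_of_ne_zero hcA.ne' hj ℓ).trans h1

/-- **Lemma 6.15, case `p ≠ r` (flat form: "switching primes on `D`").** The two expressions of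
Prop. 6.13 for the same ratio `δ_{d',prM}/δ_{D,M}` (`D = d'pr`),
`δ₁ · i_p² · j_r² = δ₂ · c_p(A₁) c_r(A₂)` and `δ₁ · i_r² · j_p² = δ₂ · c_r(A₁) c_p(A₂)`
(`A₁ = A_{d',prM}`, `A₂ = A_{D,M}`, `i_· = i_·(d',prM)`, `j_· = j_·(D,M)`), together with Lemma 6.8
for `c_p(A₁), c_p(A₂)` against `c_p(E)` and `c_r(A₁), c_r(A₂)` against `c_r(E)` and the bound
`v_ℓ(i_p) ≤ K` (Lemma 6.14), give `v_ℓ(j_p) ≤ v_ℓ(j_r) + K + 2 log_ℓ 163` ("we obtain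
`|v_ℓ(j_p(D,M)) − v_ℓ(j_r(D,M))| ≤ α_S(ℓ)`"). All quantities are positive integers.
[cite: PastenShimura2024, Lemma 6.15 p. 24 (proof, case p ≠ r), with Prop. 6.13 p. 23] -/
theorem factorization_le_of_two_identities {δ₁ δ₂ ip ir jp jr cp1 cr1 cp2 cr2 cpE crE K ℓ : ℕ}
    (hδ₁ : 0 < δ₁) (hδ₂ : 0 < δ₂) (hip : 0 < ip) (hir : 0 < ir) (hjp : 0 < jp) (hjr : 0 < jr)
    (hcpE : 0 < cpE) (hcrE : 0 < crE)
    (h1 : δ₁ * (ip ^ 2 * jr ^ 2) = δ₂ * (cp1 * cr2))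
    (h2 : δ₁ * (ir ^ 2 * jp ^ 2) = δ₂ * (cr1 * cp2))
    (hcp1 : ∃ a b : ℕ, 0 < a ∧ a ≤ 163 ∧ 0 < b ∧ b ≤ 163 ∧ cp1 * b = a * cpE)
    (hcp2 : ∃ a b : ℕ, 0 < a ∧ a ≤ 163 ∧ 0 < b ∧ b ≤ 163 ∧ cp2 * b = a * cpE)
    (hcr1 : ∃ a b : ℕ, 0 < a ∧ a ≤ 163 ∧ 0 < b ∧ b ≤ 163 ∧ cr1 * b = a * crE)
    (hcr2 : ∃ a b : ℕ, 0 < a ∧ a ≤ 163 ∧ 0 < b ∧ b ≤ 163 ∧ cr2 * b = a * crE)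
    (hK : ip.factorization ℓ ≤ K) :
    jp.factorization ℓ ≤ jr.factorization ℓ + K + 2 * Nat.log ℓ 163 := by
  obtain ⟨a₁, b₁, ha₁, ha₁', hb₁, hb₁', e₁⟩ := hcp1
  obtain ⟨a₂, b₂, ha₂, ha₂', hb₂, hb₂', e₂⟩ := hcp2
  obtain ⟨a₃, b₃, ha₃, ha₃', hb₃, hb₃', e₃⟩ := hcr1
  obtain ⟨a₄, b₄, ha₄, ha₄', hb₄, hb₄', e₄⟩ := hcr2
  obtain ⟨hcp1, hp1, hp1'⟩ := factorization_dist_le_log_of_mul_eq_mul ha₁ ha₁' hb₁ hb₁' hcpE e₁ ℓ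
  obtain ⟨hcp2, hp2, hp2'⟩ := factorization_dist_le_log_of_mul_eq_mul ha₂ ha₂' hb₂ hb₂' hcpE e₂ ℓ
  obtain ⟨hcr1, hr1, hr1'⟩ := factorization_dist_le_log_of_mul_eq_mul ha₃ ha₃' hb₃ hb₃' hcrE e₃ ℓ
  obtain ⟨hcr2, hr2, hr2'⟩ := factorization_dist_le_log_of_mul_eq_mul ha₄ ha₄' hb₄ hb₄' hcrE e₄ ℓ
  -- cross-multiplying the two identities and cancelling `δ₁ δ₂`:
  have key : ip ^ 2 * jr ^ 2 * (cr1 * cp2) = ir ^ 2 * jp ^ 2 * (cp1 * cr2) := by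
    have h3 : δ₁ * δ₂ * (ip ^ 2 * jr ^ 2 * (cr1 * cp2)) =
        δ₁ * δ₂ * (ir ^ 2 * jp ^ 2 * (cp1 * cr2)) := by
      calc δ₁ * δ₂ * (ip ^ 2 * jr ^ 2 * (cr1 * cp2))
          = (δ₁ * (ip ^ 2 * jr ^ 2)) * (δ₂ * (cr1 * cp2)) := by ring
        _ = (δ₂ * (cp1 * cr2)) * (δ₁ * (ir ^ 2 * jp ^ 2)) := by rw [h1, h2]
        _ = δ₁ * δ₂ * (ir ^ 2 * jp ^ 2 * (cp1 * cr2)) := by ring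
    exact Nat.eq_of_mul_eq_mul_left (Nat.mul_pos hδ₁ hδ₂) h3
  have hv := congrArg (fun n : ℕ => n.factorization ℓ) key
  simp only [factorization_mul_apply (mul_ne_zero (pow_ne_zero 2 hip.ne') (pow_ne_zero 2 hjr.ne'))
      (mul_ne_zero hcr1.ne' hcp2.ne'),
    factorization_mul_apply (pow_ne_zero 2 hip.ne') (pow_ne_zero 2 hjr.ne'),
    factorization_mul_apply hcr1.ne' hcp2.ne',
    factorization_mul_apply (mul_ne_zero (pow_ne_zero 2 hir.ne') (pow_ne_zero 2 hjp.ne'))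
      (mul_ne_zero hcp1.ne' hcr2.ne'),
    factorization_mul_apply (pow_ne_zero 2 hir.ne') (pow_ne_zero 2 hjp.ne'),
    factorization_mul_apply hcp1.ne' hcr2.ne', factorization_pow_apply] at hv
  omega

/-- **Lemma 6.16 (flat form: "switching primes on `M`").** With `D = pqd`, `M = rtm` and the four
factorisations `a = (d, pqrtm)`, `b = (pqd, rtm)`, `c = (pqrtd, m)`, `d = (prd, qtm)`, the four
instances of Prop. 6.13 — (I1) `δ_a i_q(a)² j_p(b)² = δ_b c_q(A_a) c_p(A_b)`, (I2)
`δ_b i_r(b)² j_t(c)² = δ_c c_r(A_b) c_t(A_c)`, (I3) `δ_a i_p(a)² j_r(d)² = δ_d c_p(A_a) c_r(A_d)`,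
(I4) `δ_d i_q(d)² j_t(c)² = δ_c c_q(A_d) c_t(A_c)` — express `δ_a/δ_c` in two ways ((EqEXP1) =
(EqEXP2)), in which `j_t(c)` and `c_t(A_c)` appear on both sides; with Lemma 6.8 for the `c`'s
(against `c_q(E), c_p(E), c_r(E), c_t(E)`), `v_ℓ(i_p(a)), v_ℓ(i_q(d)) ≤ K` (Lemma 6.14) and
`j_r(d) ∣ c_r(A_d)` (Lemma 6.15 on the prime `r ∣ prd`), one gets
`v_ℓ(j_p(b)) ≤ v_ℓ(c_r(E)) + 2K + 4 log_ℓ 163`. All quantities are positive integers.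
[cite: PastenShimura2024, Lemma 6.16 p. 24 (proof, (EqEXP1) = (EqEXP2)), with Prop. 6.13 p. 23] -/
theorem factorization_le_of_four_identities
    {δa δb δc δd iqa jpb irb jtc ipa jrd iqd cqAa cpAb crAb ctAc cpAa crAd cqAd
      cqE cpE crE ctE K ℓ : ℕ}
    (hδa : 0 < δa) (hδb : 0 < δb) (hδc : 0 < δc) (hδd : 0 < δd)
    (hiqa : 0 < iqa) (hjpb : 0 < jpb) (hirb : 0 < irb) (hjtc : 0 < jtc) (hipa : 0 < ipa)
    (hjrd : 0 < jrd) (hiqd : 0 < iqd)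
    (hcqE : 0 < cqE) (hcpE : 0 < cpE) (hcrE : 0 < crE) (hctE : 0 < ctE)
    (I1 : δa * (iqa ^ 2 * jpb ^ 2) = δb * (cqAa * cpAb))
    (I2 : δb * (irb ^ 2 * jtc ^ 2) = δc * (crAb * ctAc))
    (I3 : δa * (ipa ^ 2 * jrd ^ 2) = δd * (cpAa * crAd))
    (I4 : δd * (iqd ^ 2 * jtc ^ 2) = δc * (cqAd * ctAc))
    (h1 : ∃ a b : ℕ, 0 < a ∧ a ≤ 163 ∧ 0 < b ∧ b ≤ 163 ∧ cqAa * b = a * cqE)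
    (h2 : ∃ a b : ℕ, 0 < a ∧ a ≤ 163 ∧ 0 < b ∧ b ≤ 163 ∧ cpAb * b = a * cpE)
    (h3 : ∃ a b : ℕ, 0 < a ∧ a ≤ 163 ∧ 0 < b ∧ b ≤ 163 ∧ crAb * b = a * crE)
    (h4 : ∃ a b : ℕ, 0 < a ∧ a ≤ 163 ∧ 0 < b ∧ b ≤ 163 ∧ ctAc * b = a * ctE)
    (h5 : ∃ a b : ℕ, 0 < a ∧ a ≤ 163 ∧ 0 < b ∧ b ≤ 163 ∧ cpAa * b = a * cpE)
    (h6 : ∃ a b : ℕ, 0 < a ∧ a ≤ 163 ∧ 0 < b ∧ b ≤ 163 ∧ crAd * b = a * crE)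
    (h7 : ∃ a b : ℕ, 0 < a ∧ a ≤ 163 ∧ 0 < b ∧ b ≤ 163 ∧ cqAd * b = a * cqE)
    (hKp : ipa.factorization ℓ ≤ K) (hKq : iqd.factorization ℓ ≤ K)
    (hj : jrd ∣ crAd) :
    jpb.factorization ℓ ≤ crE.factorization ℓ + 2 * K + 4 * Nat.log ℓ 163 := by
  obtain ⟨a₁, b₁, ha₁, ha₁', hb₁, hb₁', e₁⟩ := h1
  obtain ⟨a₂, b₂, ha₂, ha₂', hb₂, hb₂', e₂⟩ := h2
  obtain ⟨a₃, b₃, ha₃, ha₃', hb₃, hb₃', e₃⟩ := h3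
  obtain ⟨a₄, b₄, ha₄, ha₄', hb₄, hb₄', e₄⟩ := h4
  obtain ⟨a₅, b₅, ha₅, ha₅', hb₅, hb₅', e₅⟩ := h5
  obtain ⟨a₆, b₆, ha₆, ha₆', hb₆, hb₆', e₆⟩ := h6
  obtain ⟨a₇, b₇, ha₇, ha₇', hb₇, hb₇', e₇⟩ := h7
  obtain ⟨hcqAa, hv1, hv1'⟩ := factorization_dist_le_log_of_mul_eq_mul ha₁ ha₁' hb₁ hb₁' hcqE e₁ ℓ
  obtain ⟨hcpAb, hv2, hv2'⟩ := factorization_dist_le_log_of_mul_eq_mul ha₂ ha₂' hb₂ hb₂' hcpE e₂ ℓ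
  obtain ⟨hcrAb, hv3, hv3'⟩ := factorization_dist_le_log_of_mul_eq_mul ha₃ ha₃' hb₃ hb₃' hcrE e₃ ℓ
  obtain ⟨hctAc, hv4, hv4'⟩ := factorization_dist_le_log_of_mul_eq_mul ha₄ ha₄' hb₄ hb₄' hctE e₄ ℓ
  obtain ⟨hcpAa, hv5, hv5'⟩ := factorization_dist_le_log_of_mul_eq_mul ha₅ ha₅' hb₅ hb₅' hcpE e₅ ℓ
  obtain ⟨hcrAd, hv6, hv6'⟩ := factorization_dist_le_log_of_mul_eq_mul ha₆ ha₆' hb₆ hb₆' hcrE e₆ ℓ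
  obtain ⟨hcqAd, hv7, hv7'⟩ := factorization_dist_le_log_of_mul_eq_mul ha₇ ha₇' hb₇ hb₇' hcqE e₇ ℓ
  have hvj := factorization_le_of_dvd_of_ne_zero hcrAd.ne' hj ℓ
  -- (EqEXP1) = (EqEXP2): `X₁ X₂ Y₃ Y₄ = X₃ X₄ Y₁ Y₂` after cancelling `δ_a δ_b δ_d`
  set X₁ := iqa ^ 2 * jpb ^ 2
  set X₂ := irb ^ 2 * jtc ^ 2
  set X₃ := ipa ^ 2 * jrd ^ 2
  set X₄ := iqd ^ 2 * jtc ^ 2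
  set Y₁ := cqAa * cpAb
  set Y₂ := crAb * ctAc
  set Y₃ := cpAa * crAd
  set Y₄ := cqAd * ctAc
  have hA : δa * (X₁ * X₂) = δc * (Y₁ * Y₂) := by
    have : δb * (δa * (X₁ * X₂)) = δb * (δc * (Y₁ * Y₂)) := by
      calc δb * (δa * (X₁ * X₂)) = (δa * X₁) * (δb * X₂) := by ring
        _ = (δb * Y₁) * (δc * Y₂) := by rw [I1, I2]
        _ = δb * (δc * (Y₁ * Y₂)) := by ring
    exact Nat.eq_of_mul_eq_mul_left hδb this
  have hB : δa * (X₃ * X₄) = δc * (Y₃ * Y₄) := by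
    have : δd * (δa * (X₃ * X₄)) = δd * (δc * (Y₃ * Y₄)) := by
      calc δd * (δa * (X₃ * X₄)) = (δa * X₃) * (δd * X₄) := by ring
        _ = (δd * Y₃) * (δc * Y₄) := by rw [I3, I4]
        _ = δd * (δc * (Y₃ * Y₄)) := by ring
    exact Nat.eq_of_mul_eq_mul_left hδd this
  have key : X₁ * X₂ * (Y₃ * Y₄) = X₃ * X₄ * (Y₁ * Y₂) := by
    have : δa * δc * (X₁ * X₂ * (Y₃ * Y₄)) = δa * δc * (X₃ * X₄ * (Y₁ * Y₂)) := by
      calc δa * δc * (X₁ * X₂ * (Y₃ * Y₄)) = (δa * (X₁ * X₂)) * (δc * (Y₃ * Y₄)) := by ring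
        _ = (δc * (Y₁ * Y₂)) * (δa * (X₃ * X₄)) := by rw [hA, hB]
        _ = δa * δc * (X₃ * X₄ * (Y₁ * Y₂)) := by ring
    exact Nat.eq_of_mul_eq_mul_left (Nat.mul_pos hδa hδc) this
  have hX₁ : X₁ ≠ 0 := mul_ne_zero (pow_ne_zero 2 hiqa.ne') (pow_ne_zero 2 hjpb.ne')
  have hX₂ : X₂ ≠ 0 := mul_ne_zero (pow_ne_zero 2 hirb.ne') (pow_ne_zero 2 hjtc.ne')
  have hX₃ : X₃ ≠ 0 := mul_ne_zero (pow_ne_zero 2 hipa.ne') (pow_ne_zero 2 hjrd.ne')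
  have hX₄ : X₄ ≠ 0 := mul_ne_zero (pow_ne_zero 2 hiqd.ne') (pow_ne_zero 2 hjtc.ne')
  have hY₁ : Y₁ ≠ 0 := mul_ne_zero hcqAa.ne' hcpAb.ne'
  have hY₂ : Y₂ ≠ 0 := mul_ne_zero hcrAb.ne' hctAc.ne'
  have hY₃ : Y₃ ≠ 0 := mul_ne_zero hcpAa.ne' hcrAd.ne'
  have hY₄ : Y₄ ≠ 0 := mul_ne_zero hcqAd.ne' hctAc.ne'
  have hv := congrArg (fun n : ℕ => n.factorization ℓ) key
  simp only [factorization_mul_apply (mul_ne_zero hX₁ hX₂) (mul_ne_zero hY₃ hY₄),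
    factorization_mul_apply (mul_ne_zero hX₃ hX₄) (mul_ne_zero hY₁ hY₂),
    factorization_mul_apply hX₁ hX₂, factorization_mul_apply hX₃ hX₄,
    factorization_mul_apply hY₁ hY₂, factorization_mul_apply hY₃ hY₄] at hv
  simp only [X₁, X₂, X₃, X₄, Y₁, Y₂, Y₃, Y₄,
    factorization_mul_apply (pow_ne_zero 2 hiqa.ne') (pow_ne_zero 2 hjpb.ne'),
    factorization_mul_apply (pow_ne_zero 2 hirb.ne') (pow_ne_zero 2 hjtc.ne'),
    factorization_mul_apply (pow_ne_zero 2 hipa.ne') (pow_ne_zero 2 hjrd.ne'),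
    factorization_mul_apply (pow_ne_zero 2 hiqd.ne') (pow_ne_zero 2 hjtc.ne'),
    factorization_mul_apply hcqAa.ne' hcpAb.ne', factorization_mul_apply hcrAb.ne' hctAc.ne',
    factorization_mul_apply hcpAa.ne' hcrAd.ne', factorization_mul_apply hcqAd.ne' hctAc.ne',
    factorization_pow_apply] at hv
  omega

/-- **From valuation bounds to divisibility by an absolute constant.** If `j ≥ 1` has
`v_ℓ(j) ≤ α(ℓ)` at every prime `ℓ`, and `α(ℓ) = 0` for primes `ℓ ≥ B`, then `j` divides the
constant `∏_{ℓ < B prime} ℓ^{α(ℓ)}` (Thm. 6.17: "for every prime `ℓ` we have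
`v_ℓ(j_p(D,M)) ≤ α(ℓ)`. Hence, there is an absolute integer constant `κ ≥ 1` supported on primes
`≤ 163` such that `j_p(D,M)` divides `κ`"). [cite: PastenShimura2024, Thm. 6.17 p. 24] -/
theorem dvd_prod_pow_of_factorization_le {j B : ℕ} {α : ℕ → ℕ} (hj : j ≠ 0)
    (hle : ∀ ℓ : ℕ, ℓ.Prime → j.factorization ℓ ≤ α ℓ)
    (hzero : ∀ ℓ : ℕ, ℓ.Prime → B ≤ ℓ → α ℓ = 0) :
    j ∣ ∏ ℓ ∈ (Finset.range B).filter Nat.Prime, ℓ ^ α ℓ := by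
  set s := (Finset.range B).filter Nat.Prime with hs
  have hsupp : j.primeFactors ⊆ s := by
    intro ℓ hℓ
    have hℓp := Nat.prime_of_mem_primeFactors hℓ
    have hpos : 0 < j.factorization ℓ := Nat.Prime.factorization_pos_of_dvd hℓp hj
      (Nat.dvd_of_mem_primeFactors hℓ)
    rw [hs, Finset.mem_filter, Finset.mem_range]
    refine ⟨?_, hℓp⟩
    by_contra hB
    have := hle ℓ hℓp
    rw [hzero ℓ hℓp (not_lt.mp hB)] at this
    omega
  have hjprod : ∏ ℓ ∈ s, ℓ ^ j.factorization ℓ = j := by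
    calc ∏ ℓ ∈ s, ℓ ^ j.factorization ℓ = ∏ ℓ ∈ j.primeFactors, ℓ ^ j.factorization ℓ :=
          (Finset.prod_subset hsupp fun ℓ _ hℓ => by
            rw [Finsupp.notMem_support_iff.mp (by rwa [Nat.support_factorization]), pow_zero]).symm
      _ = j.factorization.prod (· ^ ·) := by simp only [Finsupp.prod, Nat.support_factorization]
      _ = j := Nat.prod_factorization_pow_eq_self hj
  conv_lhs => rw [← hjprod]
  exact Finset.prod_dvd_prod_of_dvd _ _ fun ℓ hℓ =>
    pow_dvd_pow ℓ (hle ℓ (Finset.mem_filter.mp hℓ).2)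

/-- The constant `∏_{ℓ < B prime} ℓ^{α(ℓ)}` is `≥ 1` and supported on primes `< B`. [folklore] -/
theorem one_le_prod_pow_and_primeFactors_lt (B : ℕ) (α : ℕ → ℕ) :
    1 ≤ ∏ ℓ ∈ (Finset.range B).filter Nat.Prime, ℓ ^ α ℓ ∧
      ∀ p ∈ (∏ ℓ ∈ (Finset.range B).filter Nat.Prime, ℓ ^ α ℓ).primeFactors, p < B := by
  constructor
  · exact Nat.one_le_iff_ne_zero.mpr (Finset.prod_ne_zero_iff.mpr fun ℓ hℓ =>
      pow_ne_zero _ (Finset.mem_filter.mp hℓ).2.ne_zero)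
  · intro p hp
    have hpp := Nat.prime_of_mem_primeFactors hp
    obtain ⟨ℓ, hℓ, hdvd⟩ := (Nat.Prime.prime hpp).dvd_finsetProd_iff _ |>.mp
      (Nat.dvd_of_mem_primeFactors hp)
    obtain ⟨hℓB, hℓp⟩ := Finset.mem_filter.mp hℓ
    rw [(Nat.prime_dvd_prime_iff_eq hpp hℓp).mp (hpp.dvd_of_dvd_pow hdvd)]
    exact Finset.mem_range.mp hℓB

/-- **Perfect powers from factorisations.** If every prime exponent of `n ≠ 0` outside `S` is
divisible by `L`, then `n = m · k^L` with `m ≥ 1` supported on `S` (the contrapositive form in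
which Lemmas 6.10–6.12 are applied in the proof of Thm. 6.17: "if `ℓ ≤ 7` then there is some
prime `r ∣ N` such that `ℓ³ ∤ c_r(E)`, except, perhaps, for finitely many elliptic curves").
[folklore] -/
theorem exists_eq_mul_pow_of_dvd_factorization {n L : ℕ} (S : Finset ℕ) (hn : n ≠ 0)
    (h : ∀ p : ℕ, p.Prime → p ∉ S → L ∣ n.factorization p) :
    ∃ m k : ℕ, 0 < m ∧ (∀ p : ℕ, p.Prime → p ∣ m → p ∈ S) ∧ n = m * k ^ L := by
  classical
  -- `m` = the `S`-part of `n`, `k` = the `L`-th root of the rest, prime by prime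
  set fm : ℕ →₀ ℕ := n.factorization.filter (· ∈ S) with hfm
  set fk : ℕ →₀ ℕ := (n.factorization.filter (· ∉ S)).mapRange (· / L) (by simp) with hfk
  have hfm_prime : ∀ p ∈ fm.support, p.Prime := fun p hp => by
    rw [hfm, Finsupp.support_filter] at hp
    exact Nat.prime_of_mem_primeFactors (Finset.mem_filter.mp hp).1
  have hfk_prime : ∀ p ∈ fk.support, p.Prime := fun p hp => by
    have hp' : p ∈ (n.factorization.filter (· ∉ S)).support := Finsupp.support_mapRange hp
    rw [Finsupp.support_filter] at hp'
    exact Nat.prime_of_mem_primeFactors (Finset.mem_filter.mp hp').1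
  set m := fm.prod (· ^ ·) with hm
  set k := fk.prod (· ^ ·) with hk
  have hm0 : m ≠ 0 := Finsupp.prod_ne_zero_iff.mpr fun p hp => pow_ne_zero _ (hfm_prime p hp).ne_zero
  have hk0 : k ≠ 0 := Finsupp.prod_ne_zero_iff.mpr fun p hp => pow_ne_zero _ (hfk_prime p hp).ne_zero
  have hmf : m.factorization = fm := Nat.prod_pow_factorization_eq_self hfm_prime
  have hkf : k.factorization = fk := Nat.prod_pow_factorization_eq_self hfk_prime
  refine ⟨m, k, Nat.pos_of_ne_zero hm0, fun p hp hpm => ?_, ?_⟩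
  · have : p ∈ m.factorization.support := by
      rw [Nat.support_factorization]
      exact Nat.mem_primeFactors.mpr ⟨hp, hpm, hm0⟩
    rw [hmf, hfm, Finsupp.support_filter] at this
    exact (Finset.mem_filter.mp this).2
  · refine Nat.eq_of_factorization_eq hn (mul_ne_zero hm0 (pow_ne_zero _ hk0)) fun p => ?_
    rw [Nat.factorization_mul hm0 (pow_ne_zero _ hk0), Nat.factorization_pow, Finsupp.add_apply,
      Finsupp.smul_apply, smul_eq_mul, hmf, hkf, hfm, hfk, Finsupp.mapRange_apply,
      Finsupp.filter_apply, Finsupp.filter_apply]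
    by_cases hpS : p ∈ S
    · simp [hpS]
    · simp only [hpS, if_false, if_true, zero_add, not_false_eq_true]
      by_cases hp : p.Prime
      · exact (Nat.mul_div_cancel' (h p hp hpS)).symm
      · simp [Nat.factorization_eq_zero_of_not_prime _ hp]

/-! ## II. Arithmetic of conductors, minimal discriminants and admissible factorisations -/

/-- **`N = D · (rtm) ⟹ N = (Drt) · m` is admissible** — the factorisations `(pqrtd, m)` of
Lemma 6.16 (p. 24: "Let us write `D = pqd` and `M = rtm`"): if `N = DM` is admissible and `r ≠ t`
are primes of `M` dividing `N` exactly once (primes of multiplicative reduction), then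
`M = (M/(rt)) · rt` and `N = (D·rt) · (M/(rt))` is admissible.
[cite: PastenShimura2024, Lemma 6.16 p. 24 (proof, the factorisation (pqrtd, m))] -/
theorem IsAdmissibleFactorization.insert_two_primes {N D M r t : ℕ}
    (h : IsAdmissibleFactorization N D M) (hr : r.Prime) (ht : t.Prime) (hrt : r ≠ t)
    (hrM : r ∣ M) (htM : t ∣ M) (hr2 : ¬ r ^ 2 ∣ N) (ht2 : ¬ t ^ 2 ∣ N) :
    M = M / (r * t) * (r * t) ∧ IsAdmissibleFactorization N (D * (r * t)) (M / (r * t)) := by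
  have hrtM : r * t ∣ M :=
    Nat.Coprime.mul_dvd_of_dvd_of_dvd ((Nat.coprime_primes hr ht).mpr hrt) hrM htM
  set m := M / (r * t) with hm
  have hM : M = m * (r * t) := (Nat.div_mul_cancel hrtM).symm
  have hN : D * (r * t) * m = N := by rw [← h.mul_eq, hM]; ring
  -- `r, t ∤ m`: they divide `N` exactly once
  have hrm : ¬ r ∣ m := fun ⟨m', hm'⟩ => hr2 ⟨D * t * m', by rw [← hN, hm']; ring⟩
  have htm : ¬ t ∣ m := fun ⟨m', hm'⟩ => ht2 ⟨D * r * m', by rw [← hN, hm']; ring⟩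
  -- `r, t ∤ D`: coprimality of `D` and `M`
  have hrD : ¬ r ∣ D := fun hrD =>
    hr.one_lt.ne' ((Nat.Coprime.coprime_dvd_left hrD h.coprime).eq_one_of_dvd hrM)
  have htD : ¬ t ∣ D := fun htD =>
    ht.one_lt.ne' ((Nat.Coprime.coprime_dvd_left htD h.coprime).eq_one_of_dvd htM)
  have hDrt : D.Coprime (r * t) :=
    Nat.Coprime.mul_right (Nat.Coprime.symm ((Nat.Prime.coprime_iff_not_dvd hr).mpr hrD))
      (Nat.Coprime.symm ((Nat.Prime.coprime_iff_not_dvd ht).mpr htD))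
  have hpf_rt : (r * t).primeFactors = {r, t} := by
    rw [Nat.primeFactors_mul hr.ne_zero ht.ne_zero, hr.primeFactors, ht.primeFactors,
      ← Finset.insert_eq]
  refine ⟨hM, ⟨h.pos, hN, ?_, ?_, ?_⟩⟩
  · rw [Nat.squarefree_mul_iff]
    refine ⟨hDrt, h.squarefree, ?_⟩
    rw [Nat.squarefree_mul_iff]
    exact ⟨(Nat.coprime_primes hr ht).mpr hrt, hr.prime.squarefree, ht.prime.squarefree⟩
  · have hdisj : Disjoint D.primeFactors {r, t} := hpf_rt ▸ hDrt.disjoint_primeFactors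
    rw [hDrt.primeFactors_mul, hpf_rt, Finset.card_union_of_disjoint hdisj, Finset.card_pair hrt,
      Nat.even_add]
    exact iff_of_true h.even_card_primeFactors even_two
  · refine Nat.Coprime.mul_left (Nat.Coprime.coprime_dvd_right ⟨r * t, hM⟩ h.coprime) ?_
    exact Nat.Coprime.mul_left ((Nat.Prime.coprime_iff_not_dvd hr).mpr hrm)
      ((Nat.Prime.coprime_iff_not_dvd ht).mpr htm)

/-- A prime `p` of an admissible `D` does not divide `M`, and `p² ∤ p · r · M` for a second prime
`r ≠ p` (the hypothesis "`p` exactly divides `prM`" of Lemma 6.14 at the level `(d, prM)`).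
[cite: PastenShimura2024, §2 p. 12 (admissible factorization) and Lemma 6.14 p. 23] -/
theorem IsAdmissibleFactorization.not_sq_dvd_mul_of_dvd {N D M p r : ℕ}
    (h : IsAdmissibleFactorization N D M) (hp : p.Prime) (hr : r.Prime) (hpr : p ≠ r)
    (hpD : p ∣ D) : ¬ p ∣ M ∧ p ∣ p * r * M ∧ ¬ p ^ 2 ∣ p * r * M := by
  have hpM : ¬ p ∣ M := fun hpM =>
    hp.one_lt.ne' ((Nat.Coprime.coprime_dvd_left hpD h.coprime).eq_one_of_dvd hpM)
  refine ⟨hpM, ⟨r * M, by ring⟩, fun h2 => ?_⟩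
  have h2' : p * p ∣ p * (r * M) := by simpa [sq, mul_assoc] using h2
  rcases (Nat.Prime.dvd_mul hp).mp (Nat.dvd_of_mul_dvd_mul_left hp.pos h2') with hpr' | hpM'
  · exact hpr ((Nat.prime_dvd_prime_iff_eq hp hr).mp hpr')
  · exact hpM hpM'

/-- **`p ∣ N_E ⟹ v_p(Δ_E) ≥ 1`**: the conductor and the minimal discriminant have the same prime
factors (Silverman AEC VIII.11 / VII.5.1(a): the tree's discharged `radical_conductorNorm_eq_holds`),
so `c_p(E) = v_p(Δ_E)` (§6.4 p. 22) is a positive integer at every bad prime. [cite: PastenShimura2024, §6.4 p. 22 (c_p(A) := v_p(Δ_A))] -/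
theorem factorization_minimalDiscriminantNorm_pos_of_dvd (W : WeierstrassCurve ℚ) [W.IsElliptic]
    {p : ℕ} (hp : p.Prime) (hpN : p ∣ W.conductorNorm ℤ) :
    0 < (W.minimalDiscriminantNorm ℤ).factorization p := by
  have hrad : UniqueFactorizationMonoid.radical (W.conductorNorm ℤ) =
      UniqueFactorizationMonoid.radical (W.minimalDiscriminantNorm ℤ) :=
    W.radical_conductorNorm_eq_holds
  have hmem : p ∈ (W.minimalDiscriminantNorm ℤ).primeFactors := by
    rw [← Nat.primeFactors_radical, ← hrad, Nat.primeFactors_radical]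
    exact Nat.mem_primeFactors.mpr ⟨hp, hpN, (W.conductorNorm_pos_holds).ne'⟩
  rw [← Nat.support_factorization] at hmem
  exact Nat.pos_of_ne_zero (Finsupp.mem_support_iff.mp hmem)

/-- Conversely `v_p(Δ_E) ≠ 0 ⟹ p ∣ N_E` (same prime factors). [folklore] -/
theorem dvd_conductorNorm_of_factorization_ne_zero (W : WeierstrassCurve ℚ) [W.IsElliptic] {p : ℕ}
    (h : (W.minimalDiscriminantNorm ℤ).factorization p ≠ 0) : p ∣ W.conductorNorm ℤ := by
  have hrad : UniqueFactorizationMonoid.radical (W.conductorNorm ℤ) =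
      UniqueFactorizationMonoid.radical (W.minimalDiscriminantNorm ℤ) :=
    W.radical_conductorNorm_eq_holds
  have hmem : p ∈ (W.minimalDiscriminantNorm ℤ).primeFactors := by
    rw [← Nat.support_factorization]
    exact Finsupp.mem_support_iff.mpr h
  rw [← Nat.primeFactors_radical, ← hrad, Nat.primeFactors_radical] at hmem
  exact Nat.dvd_of_mem_primeFactors hmem

/-- **A semistable curve has squarefree conductor**: `p² ∤ N_E` for every prime `p` (the tree's
`isSemistable_iff_squarefree_conductorNorm`; Thm. 6.17 (i): for semistable `E` every prime of `N`
is multiplicative). [folklore] -/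
theorem not_sq_dvd_conductorNorm_of_isSemistable (W : WeierstrassCurve ℚ) [W.IsElliptic]
    (hW : W.IsSemistable ℤ) {p : ℕ} (hp : p.Prime) : ¬ p ^ 2 ∣ W.conductorNorm ℤ := fun h2 =>
  hp.one_lt.ne' (Nat.isUnit_iff.mp ((W.isSemistable_iff_squarefree_conductorNorm.mp hW) p
    (by simpa [sq] using h2)))

/-- **A Frey–Hellegouarch curve is semistable at every odd prime**: `q² ∤ N_E` for odd primes `q`
(Thm. 6.17 (ii): "at least two odd primes (which are necessarily of multiplicative reduction)";
Pasten §3 p. 13). Over the tree: `N(C • W) = N(W)` (`conductorNorm_smul_rat`) and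
`N(E_{a,b}) ∣ 2⁸ rad(ab(a+b))` (`conductorNorm_freyCurve_dvd_holds`), the radical being squarefree.
[cite: PastenShimura2024, Thm. 6.17 p. 24 (case (ii)) and §3 p. 13] -/
theorem not_sq_dvd_conductorNorm_of_isFreyHellegouarch {W : WeierstrassCurve ℚ} [W.IsElliptic]
    (hW : IsFreyHellegouarch W) {q : ℕ} (hq : q.Prime) (hq2 : q ≠ 2) :
    ¬ q ^ 2 ∣ W.conductorNorm ℤ := by
  obtain ⟨a, b, C, ha, hb, hcop, hCW⟩ := hW
  have hab : IsCoprime (a : ℤ) (b : ℤ) := Nat.isCoprime_iff_coprime.mpr hcop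
  have h0 : (a : ℤ) * b * (a + b) ≠ 0 := by positivity
  rw [← W.conductorNorm_smul_rat C, hCW, sq]
  intro hsqN
  have hqq : q * q ∣ 2 ^ 8 * (UniqueFactorizationMonoid.radical ((a : ℤ) * b * (a + b))).natAbs :=
    hsqN.trans (conductorNorm_freyCurve_dvd_holds a b hab h0)
  have hcop2 : Nat.Coprime (q * q) (2 ^ 8) :=
    Nat.Coprime.pow_right 8 (Nat.Coprime.mul_left ((Nat.coprime_primes hq Nat.prime_two).mpr hq2)
      ((Nat.coprime_primes hq Nat.prime_two).mpr hq2))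
  have hsqR : Squarefree (UniqueFactorizationMonoid.radical ((a : ℤ) * b * (a + b))).natAbs :=
    Int.squarefree_natAbs.mpr UniqueFactorizationMonoid.squarefree_radical
  exact hq.one_lt.ne' (Nat.isUnit_iff.mp (hsqR q (hcop2.dvd_of_dvd_mul_left hqq)))

/-- **The Fermat input of Thm. 6.17 (i) from Lemma 6.11.** For `E` semistable with a bad prime and
`ℓ ≥ 11`, if `|Δ_min(E)|` is not a perfect `ℓ`-th power `k^ℓ` (`k ≥ 2`) — Lemma 6.11 p. 23
("`Δ_E` is not a perfect `ℓ`-th power"; `|Δ| = k^ℓ` would give `Δ = (±k)^ℓ`, `ℓ` odd) — then some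
prime `r ∣ N`, necessarily multiplicative, has `ℓ ∤ c_r(E) = v_r(Δ_E)` (proof of Thm. 6.17 (i):
"Lemma 6.11 gives that there is some prime `r ∣ N` such that `ℓ ∤ c_r(E)`").
[cite: PastenShimura2024, Thm. 6.17 p. 24 (proof, case (i), ℓ ≥ 11) with Lemma 6.11 p. 23] -/
theorem fermatInput_of_isSemistable (W : WeierstrassCurve ℚ) [W.IsElliptic]
    (hW : W.IsSemistable ℤ) (hN : W.conductorNorm ℤ ≠ 1) {ℓ : ℕ}
    (h611 : ∀ k : ℕ, 2 ≤ k → W.minimalDiscriminantNorm ℤ ≠ k ^ ℓ) :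
    ∃ r : ℕ, r.Prime ∧ r ∣ W.conductorNorm ℤ ∧ ¬ r ^ 2 ∣ W.conductorNorm ℤ ∧
      ¬ ℓ ∣ (W.minimalDiscriminantNorm ℤ).factorization r := by
  by_contra hcon
  push Not at hcon
  have hΔ0 : W.minimalDiscriminantNorm ℤ ≠ 0 := (W.minimalDiscriminantNorm_pos_holds).ne'
  -- every exponent of `|Δ_min|` is divisible by `ℓ`
  have hall : ∀ p : ℕ, p.Prime → p ∉ (∅ : Finset ℕ) →
      ℓ ∣ (W.minimalDiscriminantNorm ℤ).factorization p := by
    intro p hp _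
    by_cases hv : (W.minimalDiscriminantNorm ℤ).factorization p = 0
    · simp [hv]
    · have hpN := dvd_conductorNorm_of_factorization_ne_zero W hv
      exact hcon p hp hpN (not_sq_dvd_conductorNorm_of_isSemistable W hW hp)
  obtain ⟨m, k, hm, hmS, hmk⟩ := exists_eq_mul_pow_of_dvd_factorization ∅ hΔ0 hall
  have hm1 : m = 1 := Nat.eq_one_iff_not_exists_prime_dvd.mpr fun p hp hpm =>
    Finset.notMem_empty p (hmS p hp hpm)
  rw [hm1, one_mul] at hmk
  -- `k ≥ 2`: otherwise `|Δ_min| ≤ 1` has no prime factor and `N = 1`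
  refine h611 k ?_ hmk
  by_contra hk
  have hk1 : k ^ ℓ ≤ 1 := by
    calc k ^ ℓ ≤ 1 ^ ℓ := Nat.pow_le_pow_left (by omega) ℓ
      _ = 1 := one_pow ℓ
  apply hN
  refine Nat.eq_one_iff_not_exists_prime_dvd.mpr fun p hp hpN => ?_
  have hpos := factorization_minimalDiscriminantNorm_pos_of_dvd W hp hpN
  have : (W.minimalDiscriminantNorm ℤ).factorization p = 0 := by
    rw [hmk]
    have : k ^ ℓ = 1 := le_antisymm hk1 (Nat.one_le_iff_ne_zero.mpr (hmk ▸ hΔ0))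
    rw [this, Nat.factorization_one, Finsupp.zero_apply]
  omega

/-- **The Fermat input of Thm. 6.17 (ii) from Lemma 6.12.** For a Frey–Hellegouarch curve `E`
and `ℓ ≥ 3`, if the odd part of `|Δ_min(E)|` is not a perfect `ℓ`-th power — Lemma 6.12 p. 23 —
then some ODD prime `r ∣ N`, necessarily multiplicative
(`not_sq_dvd_conductorNorm_of_isFreyHellegouarch`), has `ℓ ∤ c_r(E)` (proof of Thm. 6.17 (ii):
"we apply Lemma 6.12 instead of Lemma 6.11").
[cite: PastenShimura2024, Thm. 6.17 p. 24 (proof, case (ii)) with Lemma 6.12 p. 23] -/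
theorem fermatInput_of_isFreyHellegouarch (W : WeierstrassCurve ℚ) [W.IsElliptic]
    (hW : IsFreyHellegouarch W) {ℓ : ℕ}
    (h612 : ∀ k : ℕ, ordCompl[2] (W.minimalDiscriminantNorm ℤ) ≠ k ^ ℓ) :
    ∃ r : ℕ, r.Prime ∧ r ∣ W.conductorNorm ℤ ∧ ¬ r ^ 2 ∣ W.conductorNorm ℤ ∧
      ¬ ℓ ∣ (W.minimalDiscriminantNorm ℤ).factorization r := by
  by_contra hcon
  push Not at hcon
  have hΔ0 : W.minimalDiscriminantNorm ℤ ≠ 0 := (W.minimalDiscriminantNorm_pos_holds).ne'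
  set n := ordCompl[2] (W.minimalDiscriminantNorm ℤ) with hn
  have hn0 : n ≠ 0 := (Nat.ordCompl_pos 2 hΔ0).ne'
  -- every exponent of the odd part is divisible by `ℓ`
  have hall : ∀ p : ℕ, p.Prime → p ∉ (∅ : Finset ℕ) → ℓ ∣ n.factorization p := by
    intro p hp _
    rw [hn, Nat.factorization_ordCompl]
    by_cases hp2 : p = 2
    · subst hp2; simp
    rw [Finsupp.erase_ne hp2]
    by_cases hv : (W.minimalDiscriminantNorm ℤ).factorization p = 0
    · simp [hv]
    · have hpN := dvd_conductorNorm_of_factorization_ne_zero W hv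
      exact hcon p hp hpN (not_sq_dvd_conductorNorm_of_isFreyHellegouarch hW hp hp2)
  obtain ⟨m, k, hm, hmS, hmk⟩ := exists_eq_mul_pow_of_dvd_factorization ∅ hn0 hall
  have hm1 : m = 1 := Nat.eq_one_iff_not_exists_prime_dvd.mpr fun p hp hpm =>
    Finset.notMem_empty p (hmS p hp hpm)
  rw [hm1, one_mul] at hmk
  exact h612 k hmk

/-- In an admissible factorisation `N = DM`, a prime of `N` not dividing `D` divides `M`.
[folklore] -/
theorem IsAdmissibleFactorization.dvd_right_of_not_dvd_left {N D M r : ℕ}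
    (h : IsAdmissibleFactorization N D M) (hr : r.Prime) (hrN : r ∣ N) (hrD : ¬ r ∣ D) : r ∣ M := by
  rw [← h.mul_eq] at hrN
  exact ((Nat.Prime.dvd_mul hr).mp hrN).resolve_left hrD

/-! ## III. The Ribet–Takahashi system of an elliptic curve: Lemmas 6.14–6.16 and Thm. 6.17

Throughout this section the section variables are the two functions `cI`, `cJ` (the orders
`i_p(D,M)`, `j_p(D,M)` of the image and cokernel of `q_{D,M,p,*}` on component groups, §6.6 p. 23,
attached to the class-minimal datum rendering `q_{D,M}`) with their positivity `hI`, `hJ`, and the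
printed inputs as hypotheses on them: `h613` (Prop. 6.13), `hJc` (`j_p ∣ #Φ_p(A_{D,M})`), `h68`
(Lemma 6.8), and `h614` (Lemma 6.14 at a finite set of primes `S` with constant `κ₁ = κ_S`). -/

section RTSystem

variable (cI cJ : ∀ {D M : ℕ} {X : ShimuraCurveData D M} {W' : WeierstrassCurve ℚ},
    ShimuraParametrizationData X W' → ℕ → ℕ)
  (hI : ∀ {D M : ℕ} {X : ShimuraCurveData D M} {W' : WeierstrassCurve ℚ}
    (P : ShimuraParametrizationData X W') (p : ℕ), 0 < cI P p)
  (hJ : ∀ {D M : ℕ} {X : ShimuraCurveData D M} {W' : WeierstrassCurve ℚ}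
    (P : ShimuraParametrizationData X W') (p : ℕ), 0 < cJ P p)
  (h613 : ∀ {N d M₁ D M p r : ℕ}, p.Prime → r.Prime → p ≠ r → D = d * (p * r) →
    M₁ = p * r * M → IsAdmissibleFactorization N D M →
    ∀ (X₁ : ShimuraCurveData d M₁) (X₂ : ShimuraCurveData D M)
      (W : WeierstrassCurve ℚ) [W.IsElliptic] [W.IsGloballyMinimal], W.conductorNorm ℤ = N →
    ∀ (W₁' : WeierstrassCurve ℚ) [W₁'.IsElliptic] (P₁ : ShimuraParametrizationData X₁ W₁'),
      P₁.IsMinimalFor W →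
    ∀ (W₂' : WeierstrassCurve ℚ) [W₂'.IsElliptic] (P₂ : ShimuraParametrizationData X₂ W₂'),
      P₂.IsMinimalFor W →
      P₁.deg * (cI P₁ p ^ 2 * cJ P₂ r ^ 2) =
        P₂.deg * ((W₁'.minimalDiscriminantNorm ℤ).factorization p *
          (W₂'.minimalDiscriminantNorm ℤ).factorization r))
  (hJc : ∀ {N D M : ℕ}, IsAdmissibleFactorization N D M →
    ∀ (X : ShimuraCurveData D M) (W : WeierstrassCurve ℚ) [W.IsElliptic] [W.IsGloballyMinimal],
      W.conductorNorm ℤ = N →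
    ∀ (W' : WeierstrassCurve ℚ) [W'.IsElliptic] (P : ShimuraParametrizationData X W'),
      P.IsMinimalFor W → ∀ p : ℕ, p.Prime → p ∣ D →
      cJ P p ∣ (W'.minimalDiscriminantNorm ℤ).factorization p)
  (h68 : ∀ (W W' : WeierstrassCurve ℚ) [W.IsElliptic] [W'.IsElliptic], W.IsIsogenous W' →
    ∀ p : ℕ, p.Prime → p ∣ W.conductorNorm ℤ → ¬ p ^ 2 ∣ W.conductorNorm ℤ →
      ∃ a b : ℕ, 0 < a ∧ a ≤ 163 ∧ 0 < b ∧ b ≤ 163 ∧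
        (W'.minimalDiscriminantNorm ℤ).factorization p * b =
          a * (W.minimalDiscriminantNorm ℤ).factorization p)
  {S : Finset ℕ} {κ₁ : ℕ} (hκ₁ : 0 < κ₁)
  (h614 : ∀ {N D M : ℕ}, IsAdmissibleFactorization N D M →
    ∀ (X : ShimuraCurveData D M) (W : WeierstrassCurve ℚ) [W.IsElliptic] [W.IsGloballyMinimal],
      W.conductorNorm ℤ = N → (∀ q : ℕ, q.Prime → q ∉ S → ¬ q ^ 2 ∣ N) →
    ∀ (W' : WeierstrassCurve ℚ) [W'.IsElliptic] (P : ShimuraParametrizationData X W'),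
      P.IsMinimalFor W → ∀ p : ℕ, p.Prime → p ∣ M → ¬ p ^ 2 ∣ M → cI P p ∣ κ₁)

/-! ### Lemma 6.15: switching primes on `D` -/

include hI hJ h613 hJc h68 hκ₁ h614 in
/-- **Pasten 2024, Lemma 6.15 (switching primes on `D`), performed in the tree.** Printed (p. 24):
"Let `E` be an elliptic curve over `ℚ`, semi-stable away from `S`, and of conductor `N`. Let
`N = DM` be an admissible factorization. If `p, r` are two (possibly equal) primes dividing `D`, then
for every prime `ℓ` we have `v_ℓ(j_p(D,M)) ≤ v_ℓ(c_r(E)) + α_{S,1}(ℓ)`", with `α_{S,1}` supported on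
primes `≤ 163`; here with the explicit `α_{S,1}(ℓ) = v_ℓ(κ_S) + 3 log_ℓ 163` (which vanishes for
`ℓ > 163` as `κ_S` is supported on primes `≤ 163`). Proof as printed: `p = r` — `j_p ∣ c_p(A_{D,M})`
(`hJc`) and Lemma 6.8; `p ≠ r` — the two expressions of Prop. 6.13 for `δ_{d',prM}/δ_{D,M}`,
`d' = D/(pr)` (the curve `X₀^{d'}(prM)` from `nonempty_shimuraCurveData_holds`, a class-minimal datum
on it from the Jacquet–Langlands fact `hP`), Lemma 6.8 and Lemma 6.14 (`i_p(d',prM) ∣ κ_S`,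
`p ∥ prM`) give `|v_ℓ(j_p) − v_ℓ(j_r)| ≤ α_S(ℓ)` (`factorization_le_of_two_identities`), and the case
`p = r` for `r` finishes. [cite: PastenShimura2024, Lemma 6.15 p. 24, with Prop. 6.13 and Lemma 6.14 p. 23, Lemma 6.8 p. 22] -/
theorem PastenShimura2024_lemma_6_15 (hP : nonempty_shimuraParametrizationData) {N D M : ℕ}
    (hadm : IsAdmissibleFactorization N D M) (X : ShimuraCurveData D M) (W : WeierstrassCurve ℚ)
    [W.IsElliptic] [W.IsGloballyMinimal] (hWN : W.conductorNorm ℤ = N)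
    (hS : ∀ q : ℕ, q.Prime → q ∉ S → ¬ q ^ 2 ∣ N) (W' : WeierstrassCurve ℚ) [W'.IsElliptic]
    (P : ShimuraParametrizationData X W') (hPm : P.IsMinimalFor W) {p r : ℕ} (hp : p.Prime)
    (hr : r.Prime) (hpD : p ∣ D) (hrD : r ∣ D) (ℓ : ℕ) :
    (cJ P p).factorization ℓ ≤ ((W.minimalDiscriminantNorm ℤ).factorization r).factorization ℓ +
      κ₁.factorization ℓ + 3 * Nat.log ℓ 163 := by
  -- `p, r ∥ N`, so `c_p(E), c_r(E) ≥ 1`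
  obtain ⟨hpN, hp2N⟩ := hadm.dvd_and_not_sq_dvd hp hpD
  obtain ⟨hrN, hr2N⟩ := hadm.dvd_and_not_sq_dvd hr hrD
  rw [← hWN] at hpN hp2N hrN hr2N
  have hcpE := factorization_minimalDiscriminantNorm_pos_of_dvd W hp hpN
  have hcrE := factorization_minimalDiscriminantNorm_pos_of_dvd W hr hrN
  -- the case `p = r` for the prime `r`: `v_ℓ(j_r(D,M)) ≤ v_ℓ(c_r(E)) + log_ℓ 163`
  have hsame : ∀ {q : ℕ}, q.Prime → q ∣ D → q ∣ W.conductorNorm ℤ → ¬ q ^ 2 ∣ W.conductorNorm ℤ →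
      (cJ P q).factorization ℓ ≤
        ((W.minimalDiscriminantNorm ℤ).factorization q).factorization ℓ + Nat.log ℓ 163 := by
    intro q hq hqD hqN hq2N
    obtain ⟨a, b, ha, ha', hb, hb', e⟩ := h68 W W' hPm.1 q hq hqN hq2N
    exact factorization_le_of_dvd_of_mul_eq_mul (hJc hadm X W hWN W' P hPm q hq hqD) ha ha' hb hb'
      (factorization_minimalDiscriminantNorm_pos_of_dvd W hq hqN) e ℓ
  by_cases hpr : p = r
  · subst hpr
    exact (hsame hp hpD hpN hp2N).trans (by omega)
  -- `p ≠ r`: the level `(d', prM)`, `d' = D/(pr)`, a curve of that level and a class-minimal datum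
  obtain ⟨hDd, hadm₁, -, -⟩ := hadm.erase_two_primes hp hr hpr hpD hrD
  set d' := D / (p * r)
  obtain ⟨X₁⟩ := nonempty_shimuraCurveData_holds hadm₁
  obtain ⟨W₁', hW₁', P₁, hP₁⟩ :=
    ShimuraParametrizationData.exists_isMinimalFor_of_nonempty (hP hadm₁ X₁ W hWN)
  -- Prop. 6.13 for the pairs `(p, r)` and `(r, p)`
  have e1 := h613 hp hr hpr hDd rfl hadm X₁ X W hWN W₁' P₁ hP₁ W' P hPm
  have e2 := h613 hr hp (Ne.symm hpr) (by rw [hDd]; ring) (by ring) hadm X₁ X W hWN W₁' P₁ hP₁ W' P hPm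
  -- Lemma 6.14 for `i_p(d', prM)`: `p ∥ prM`
  obtain ⟨-, hp1, hp2⟩ := hadm.not_sq_dvd_mul_of_dvd hp hr hpr hpD
  have hi : (cI P₁ p).factorization ℓ ≤ κ₁.factorization ℓ :=
    factorization_le_of_dvd_of_ne_zero hκ₁.ne' (h614 hadm₁ X₁ W hWN hS W₁' P₁ hP₁ p hp hp1 hp2) ℓ
  have hswitch := factorization_le_of_two_identities P₁.deg_pos P.deg_pos (hI P₁ p) (hI P₁ r)
    (hJ P p) (hJ P r) hcpE hcrE e1 e2 (h68 W W₁' hP₁.1 p hp hpN hp2N) (h68 W W' hPm.1 p hp hpN hp2N)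
    (h68 W W₁' hP₁.1 r hr hrN hr2N) (h68 W W' hPm.1 r hr hrN hr2N) hi
  have hjr := hsame hr hrD hrN hr2N
  omega

/-! ### Lemma 6.16: switching primes on `M` -/

include hI hJ h613 hJc h68 hκ₁ h614 in
/-- **Pasten 2024, Lemma 6.16 (switching primes on `M`), performed in the tree.** Printed (p. 24):
"Let `E` be an elliptic curve over `ℚ`, semi-stable away from `S`, and of conductor `N`. Let `N = DM`
be an admissible factorization and suppose that `M` is divisible by at least two primes of
multiplicative reduction for `E`. If `p, r` are two primes of multiplicative reduction for `E` with
`p ∣ D` and `r ∣ M`, then for every prime `ℓ` we have `v_ℓ(j_p(D,M)) ≤ v_ℓ(c_r(E)) + α_{S,2}(ℓ)`";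
here with the explicit `α_{S,2}(ℓ) = 2 v_ℓ(κ_S) + 4 log_ℓ 163` and the second multiplicative prime
`t ≠ r` of `M` as the hypothesis `hM2`. Proof as printed: primes `q ∣ D`, `q ≠ p` (`ω(D)` is even)
and `t ∣ M`, `t ≠ r`; `D = pqd`, `M = rtm`; the four instances of Prop. 6.13 along
`(d, pqrtm) → (pqd, rtm) → (pqrtd, m)` and `(d, pqrtm) → (prd, qtm) → (pqrtd, m)` (curves from
`nonempty_shimuraCurveData_holds`, class-minimal data from `hP`; the levels
`IsAdmissibleFactorization.erase_two_primes` / `insert_two_primes`), in which `j_t(pqrtd, m)`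
appears twice; Lemma 6.8, Lemma 6.14 (`i_p(d, pqrtm)`, `i_q(prd, qtm) ∣ κ_S`) and Lemma 6.15 on the
prime `r ∣ prd` (`factorization_le_of_four_identities`).
[cite: PastenShimura2024, Lemma 6.16 p. 24, with Prop. 6.13 and Lemma 6.14 p. 23, Lemma 6.8 p. 22] -/
theorem PastenShimura2024_lemma_6_16 (hP : nonempty_shimuraParametrizationData) {N D M : ℕ}
    (hadm : IsAdmissibleFactorization N D M) (X : ShimuraCurveData D M) (W : WeierstrassCurve ℚ)
    [W.IsElliptic] [W.IsGloballyMinimal] (hWN : W.conductorNorm ℤ = N)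
    (hS : ∀ q : ℕ, q.Prime → q ∉ S → ¬ q ^ 2 ∣ N) (W' : WeierstrassCurve ℚ) [W'.IsElliptic]
    (P : ShimuraParametrizationData X W') (hPm : P.IsMinimalFor W) {p r : ℕ} (hp : p.Prime)
    (hr : r.Prime) (hpD : p ∣ D) (hrM : r ∣ M) (hr2 : ¬ r ^ 2 ∣ N)
    (hM2 : ∃ t : ℕ, t.Prime ∧ t ∣ M ∧ ¬ t ^ 2 ∣ N ∧ t ≠ r) (ℓ : ℕ) :
    (cJ P p).factorization ℓ ≤ ((W.minimalDiscriminantNorm ℤ).factorization r).factorization ℓ +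
      2 * κ₁.factorization ℓ + 4 * Nat.log ℓ 163 := by
  obtain ⟨t, ht, htM, ht2, htr⟩ := hM2
  -- a second prime `q ≠ p` of `D` (`ω(D)` is even and `p ∣ D`)
  have hpmem : p ∈ D.primeFactors :=
    Nat.mem_primeFactors.mpr ⟨hp, hpD, hadm.squarefree.ne_zero⟩
  obtain ⟨q, hq⟩ : (D.primeFactors.erase p).Nonempty := by
    refine Finset.card_pos.mp ?_
    rw [Finset.card_erase_of_mem hpmem]
    obtain ⟨n, hn⟩ := hadm.even_card_primeFactors
    have : 0 < D.primeFactors.card := Finset.card_pos.mpr ⟨p, hpmem⟩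
    omega
  obtain ⟨hqp, hq⟩ := Finset.mem_erase.mp hq
  have hqq : q.Prime := Nat.prime_of_mem_primeFactors hq
  have hqD : q ∣ D := Nat.dvd_of_mem_primeFactors hq
  -- multiplicativity: `p, q ∥ N` (primes of `D`), `r, t ∥ N` (hypotheses); positivity of the `c`'s
  obtain ⟨hpN, hp2N⟩ := hadm.dvd_and_not_sq_dvd hp hpD
  obtain ⟨hqN, hq2N⟩ := hadm.dvd_and_not_sq_dvd hqq hqD
  have hrN : r ∣ N := hrM.trans ⟨D, by rw [← hadm.mul_eq, mul_comm]⟩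
  have htN : t ∣ N := htM.trans ⟨D, by rw [← hadm.mul_eq, mul_comm]⟩
  rw [← hWN] at hpN hp2N hqN hq2N hrN htN
  have hr2' : ¬ r ^ 2 ∣ W.conductorNorm ℤ := hWN ▸ hr2
  have ht2' : ¬ t ^ 2 ∣ W.conductorNorm ℤ := hWN ▸ ht2
  have hcpE := factorization_minimalDiscriminantNorm_pos_of_dvd W hp hpN
  have hcqE := factorization_minimalDiscriminantNorm_pos_of_dvd W hqq hqN
  have hcrE := factorization_minimalDiscriminantNorm_pos_of_dvd W hr hrN
  have hctE := factorization_minimalDiscriminantNorm_pos_of_dvd W ht htN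
  -- `p ≠ r`, `q ≠ t` (a prime of `D` does not divide `M`)
  have hpM : ¬ p ∣ M := (hadm.not_sq_dvd_mul_of_dvd hp hqq (Ne.symm hqp) hpD).1
  have hqM : ¬ q ∣ M := (hadm.not_sq_dvd_mul_of_dvd hqq hp hqp hqD).1
  have hpr : p ≠ r := fun h => hpM (h ▸ hrM)
  have hqt : q ≠ t := fun h => hqM (h ▸ htM)
  -- the level `a = (d, pqM)`, `d = D/(pq)` (erase `p, q` from `D`)
  obtain ⟨hDd, hadm_a, -, -⟩ := hadm.erase_two_primes hp hqq (Ne.symm hqp) hpD hqD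
  set d := D / (p * q) with hd
  obtain ⟨X_a⟩ := nonempty_shimuraCurveData_holds hadm_a
  obtain ⟨W_a, hW_a, P_a, hPa⟩ :=
    ShimuraParametrizationData.exists_isMinimalFor_of_nonempty (hP hadm_a X_a W hWN)
  -- the level `c = (Drt, m)`, `m = M/(rt)` (insert `r, t` into `D`)
  obtain ⟨hMm, hadm_c⟩ := hadm.insert_two_primes hr ht (Ne.symm htr) hrM htM hr2 ht2
  set m := M / (r * t) with hm
  obtain ⟨X_c⟩ := nonempty_shimuraCurveData_holds hadm_c
  obtain ⟨W_c, hW_c, P_c, hPc⟩ :=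
    ShimuraParametrizationData.exists_isMinimalFor_of_nonempty (hP hadm_c X_c W hWN)
  -- the level `d = (prd, qtm)` (erase `q, t` from `Drt`)
  obtain ⟨hDc, hadm_d, -, -⟩ := hadm_c.erase_two_primes hqq ht hqt (Dvd.dvd.mul_right hqD _)
    (Dvd.intro_left (D * r) (by ring))
  set d₂ := D * (r * t) / (q * t) with hd₂
  have hd₂' : d₂ = d * (p * r) := by
    have h1 : D * (r * t) = d * (p * r) * (q * t) := by
      conv_lhs => rw [hDd]
      ring
    rw [hd₂, h1, Nat.mul_div_cancel _ (Nat.mul_pos hqq.pos ht.pos)]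
  obtain ⟨X_d⟩ := nonempty_shimuraCurveData_holds hadm_d
  obtain ⟨W_d, hW_d, P_d, hPd⟩ :=
    ShimuraParametrizationData.exists_isMinimalFor_of_nonempty (hP hadm_d X_d W hWN)
  -- the four instances of Prop. 6.13
  have I1 := h613 hqq hp hqp (by rw [hDd]; ring) (by ring) hadm X_a X W hWN W_a P_a hPa W' P hPm
  have hM₁ : p * q * M = p * r * (q * t * m) := by rw [hMm]; ring
  have I2 := h613 hr ht (Ne.symm htr) rfl (by rw [hMm]; ring) hadm_c X X_c W hWN
    W' P hPm W_c P_c hPc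
  have I3 := h613 hp hr hpr hd₂' hM₁ hadm_d X_a X_d W hWN W_a P_a hPa W_d P_d hPd
  have I4 := h613 hqq ht hqt hDc rfl hadm_c X_d X_c W hWN W_d P_d hPd W_c P_c hPc
  -- Lemma 6.14: `i_p(d, pqM) ∣ κ_S` (`p ∥ pqM`) and `i_q(prd, qtm) ∣ κ_S` (`q ∥ qtm`)
  obtain ⟨-, hp1, hp2⟩ := hadm.not_sq_dvd_mul_of_dvd hp hqq (Ne.symm hqp) hpD
  obtain ⟨-, hq1, hq2⟩ := hadm_c.not_sq_dvd_mul_of_dvd hqq ht hqt (Dvd.dvd.mul_right hqD _)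
  have hKp : (cI P_a p).factorization ℓ ≤ κ₁.factorization ℓ :=
    factorization_le_of_dvd_of_ne_zero hκ₁.ne' (h614 hadm_a X_a W hWN hS W_a P_a hPa p hp hp1 hp2) ℓ
  have hKq : (cI P_d q).factorization ℓ ≤ κ₁.factorization ℓ :=
    factorization_le_of_dvd_of_ne_zero hκ₁.ne' (h614 hadm_d X_d W hWN hS W_d P_d hPd q hqq hq1 hq2) ℓ
  -- Lemma 6.15 on the prime `r ∣ prd`: `j_r(prd, qtm) ∣ c_r(A_{prd,qtm})`
  have hj : cJ P_d r ∣ (W_d.minimalDiscriminantNorm ℤ).factorization r :=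
    hJc hadm_d X_d W hWN W_d P_d hPd r hr (hd₂' ▸ Dvd.intro_left (d * p) (by ring))
  exact factorization_le_of_four_identities P_a.deg_pos P.deg_pos P_c.deg_pos P_d.deg_pos
    (hI P_a q) (hJ P p) (hI P r) (hJ P_c t) (hI P_a p) (hJ P_d r) (hI P_d q) hcqE hcpE hcrE hctE
    I1 I2 I3 I4 (h68 W W_a hPa.1 q hqq hqN hq2N) (h68 W W' hPm.1 p hp hpN hp2N)
    (h68 W W' hPm.1 r hr hrN hr2') (h68 W W_c hPc.1 t ht htN ht2') (h68 W W_a hPa.1 p hp hpN hp2N)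
    (h68 W W_d hPd.1 r hr hrN hr2') (h68 W W_d hPd.1 q hqq hqN hq2N) hKp hKq hj

/-! ### Thm. 6.17: the uniform cokernel bound -/

include hI hJ h613 hJc h68 hκ₁ h614 in
/-- **Pasten 2024, Thm. 6.17 (bounding the cokernel), performed in the tree in the generality of its
proof.** Printed (p. 24): "There is a function `α : 𝒫 → ℤ_{≥0}` supported on primes `≤ 163`, such
that the following holds: Let `E` be an elliptic curve over `ℚ` of conductor `N`. Let `N = DM` be an
admissible factorization and suppose that either (i) `E` is semi-stable and `M` is not a prime
number, or (ii) `E` is a Frey–Hellegouarch elliptic curve and `M` is divisible by at least two odd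
primes (which are necessarily of multiplicative reduction). Let `p` be a prime with `p ∣ D`. Then for
every prime `ℓ` we have `v_ℓ(j_p(D,M)) ≤ α(ℓ)`. Hence, there is an absolute integer constant `κ ≥ 1`
supported on primes `≤ 163` such that `j_p(D,M)` divides `κ` under these assumptions." The printed
proof uses (i)/(ii) only through: `E` semistable away from `S` (`S = ∅`, resp. `{2}`: Lemmas 6.14,
6.10), the FERMAT INPUT "for `ℓ ≥ 11` there is some prime `r ∣ N` [multiplicative] such that
`ℓ ∤ c_r(E)`" (Lemma 6.11, resp. 6.12), and "`M` divisible by two multiplicative primes, or by none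
of the `r` found" (for Lemma 6.16) — here: the multiplicative primes of `M` are not exactly one.
This theorem is that statement, for an arbitrary finite `S`: the constant `κ₂` depends only on `S`,
on `κ_S` (Lemma 6.14, hypothesis `h614`) and on the finite exceptional sets of Lemma 6.10
(hypothesis `h610`, used at `L = ℓ³` for `ℓ ≤ 7`). Proof as printed: for `ℓ ≥ 11` the Fermat input,
for `ℓ ≤ 7` Lemma 6.10 (a generic curve has a prime `r ∉ S` with `ℓ³ ∤ c_r(E)`,
`exists_eq_mul_pow_of_dvd_factorization`; the finitely many exceptional curves have
`v_ℓ(j_p) ≤ v_ℓ(c_p(A_{D,M})) ≤ log_ℓ 163 + v_ℓ(c_p(E))`, bounded through their finitely many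
`|Δ_min|`), then Lemma 6.15 (`r ∣ D`) or Lemma 6.16 (`r ∣ M`); `α(ℓ) = 2 v_ℓ(κ_S) + 5 log_ℓ 163 +
[ℓ < 11](2 + B_S(ℓ))` vanishes for `ℓ > 163`, and `κ₂ = ∏_{ℓ ≤ 163} ℓ^{α(ℓ)}`
(`dvd_prod_pow_of_factorization_le`). The printed cases: `fermatInput_of_isSemistable`,
`fermatInput_of_isFreyHellegouarch`, and `PastenShimura2024_thm_6_1_b_of_ribetTakahashi_inputs` below.
[cite: PastenShimura2024, Thm. 6.17 p. 24 (statement and proof), with Lemmas 6.10–6.12 p. 23, Lemmas 6.15–6.16 p. 24, Lemma 6.8 p. 22] -/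
theorem PastenShimura2024_thm_6_17' (hP : nonempty_shimuraParametrizationData)
    (hκ₁' : ∀ q ∈ κ₁.primeFactors, q ≤ 163)
    (h610 : ∀ L : ℕ, 7 ≤ L → {Δ : ℕ | ∃ (W : WeierstrassCurve ℚ) (_ : W.IsElliptic),
        (∀ q : ℕ, q.Prime → q ∉ S → ¬ q ^ 2 ∣ W.conductorNorm ℤ) ∧
        W.minimalDiscriminantNorm ℤ = Δ ∧
        ∃ n k : ℕ, (∀ q : ℕ, q.Prime → q ∣ n → q ∈ S) ∧ Δ = n * k ^ L}.Finite) :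
    ∃ κ₂ : ℕ, 1 ≤ κ₂ ∧ (∀ q ∈ κ₂.primeFactors, q ≤ 163) ∧
      ∀ {N D M : ℕ}, IsAdmissibleFactorization N D M →
      ∀ (X : ShimuraCurveData D M) (W : WeierstrassCurve ℚ) [W.IsElliptic] [W.IsGloballyMinimal],
        W.conductorNorm ℤ = N → (∀ q : ℕ, q.Prime → q ∉ S → ¬ q ^ 2 ∣ N) →
        (∀ ℓ : ℕ, ℓ.Prime → 11 ≤ ℓ → ∃ r : ℕ, r.Prime ∧ r ∣ N ∧ ¬ r ^ 2 ∣ N ∧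
          ¬ ℓ ∣ (W.minimalDiscriminantNorm ℤ).factorization r) →
        (M.primeFactors.filter fun t => ¬ t ^ 2 ∣ N).card ≠ 1 →
      ∀ (W' : WeierstrassCurve ℚ) [W'.IsElliptic] (P : ShimuraParametrizationData X W'),
        P.IsMinimalFor W → ∀ p : ℕ, p.Prime → p ∣ D → cJ P p ∣ κ₂ := by
  classical
  -- the exceptional bound `B(ℓ)` of Lemma 6.10 at `L = ℓ³`, and the exponent function `α`
  let B : ℕ → ℕ := fun ℓ => if h : 7 ≤ ℓ ^ 3 then (h610 (ℓ ^ 3) h).toFinset.sup id else 0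
  let α : ℕ → ℕ := fun ℓ =>
    2 * κ₁.factorization ℓ + 5 * Nat.log ℓ 163 + (if ℓ < 11 then 2 + B ℓ else 0)
  have hα0 : ∀ ℓ : ℕ, ℓ.Prime → 164 ≤ ℓ → α ℓ = 0 := by
    intro ℓ hℓ h164
    have h1 : κ₁.factorization ℓ = 0 := by
      apply Finsupp.notMem_support_iff.mp
      rw [Nat.support_factorization]
      exact fun hmem => absurd (hκ₁' ℓ hmem) (by omega)
    have h2 : Nat.log ℓ 163 = 0 := Nat.log_of_lt (by omega)
    have h3 : ¬ ℓ < 11 := by omega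
    show 2 * κ₁.factorization ℓ + 5 * Nat.log ℓ 163 + (if ℓ < 11 then 2 + B ℓ else 0) = 0
    rw [h1, h2, if_neg h3]
  refine ⟨∏ ℓ ∈ (Finset.range 164).filter Nat.Prime, ℓ ^ α ℓ,
    (one_le_prod_pow_and_primeFactors_lt 164 α).1,
    fun q hq => Nat.lt_succ_iff.mp ((one_le_prod_pow_and_primeFactors_lt 164 α).2 q hq), ?_⟩
  intro N D M hadm X W _ _ hWN hS hF hM1 W' _ P hPm p hp hpD
  refine dvd_prod_pow_of_factorization_le (hJ P p).ne' (fun ℓ hℓ => ?_) hα0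
  -- the bound `v_ℓ(j_p(D,M)) ≤ α(ℓ)` at the prime `ℓ`
  obtain ⟨hpN, hp2N⟩ := hadm.dvd_and_not_sq_dvd hp hpD
  -- Lemma 6.15 or Lemma 6.16 from a multiplicative witness prime `r`
  have main : ∀ r : ℕ, r.Prime → r ∣ N → ¬ r ^ 2 ∣ N →
      (cJ P p).factorization ℓ ≤
        ((W.minimalDiscriminantNorm ℤ).factorization r).factorization ℓ +
          2 * κ₁.factorization ℓ + 4 * Nat.log ℓ 163 := by
    intro r hr hrN hr2
    by_cases hrD : r ∣ D
    · have h15 := PastenShimura2024_lemma_6_15 cI cJ hI hJ h613 hJc h68 hκ₁ h614 hP hadm X W hWN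
        hS W' P hPm hp hr hpD hrD ℓ
      omega
    · have hrM : r ∣ M := hadm.dvd_right_of_not_dvd_left hr hrN hrD
      -- a second multiplicative prime `t` of `M`
      have hmem : r ∈ M.primeFactors.filter fun t => ¬ t ^ 2 ∣ N :=
        Finset.mem_filter.mpr ⟨Nat.mem_primeFactors.mpr ⟨hr, hrM, hadm.pos_right.ne'⟩, hr2⟩
      obtain ⟨t, ht⟩ : ((M.primeFactors.filter fun t => ¬ t ^ 2 ∣ N).erase r).Nonempty := by
        refine Finset.card_pos.mp ?_
        rw [Finset.card_erase_of_mem hmem]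
        have : 0 < (M.primeFactors.filter fun t => ¬ t ^ 2 ∣ N).card :=
          Finset.card_pos.mpr ⟨r, hmem⟩
        omega
      obtain ⟨htr, ht⟩ := Finset.mem_erase.mp ht
      obtain ⟨ht1, ht2⟩ := Finset.mem_filter.mp ht
      exact PastenShimura2024_lemma_6_16 cI cJ hI hJ h613 hJc h68 hκ₁ h614 hP hadm X W hWN hS W'
        P hPm hp hr hpD hrM hr2 ⟨t, Nat.prime_of_mem_primeFactors ht1,
          Nat.dvd_of_mem_primeFactors ht1, ht2, htr⟩ ℓ
  by_cases hℓ11 : 11 ≤ ℓ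
  · -- `ℓ ≥ 11`: the Fermat input gives a multiplicative `r` with `v_ℓ(c_r(E)) = 0`
    obtain ⟨r, hr, hrN, hr2, hndvd⟩ := hF ℓ hℓ hℓ11
    have h0 : ((W.minimalDiscriminantNorm ℤ).factorization r).factorization ℓ = 0 :=
      Nat.factorization_eq_zero_of_not_dvd hndvd
    have h1 := main r hr hrN hr2
    have h3 : ¬ ℓ < 11 := by omega
    show _ ≤ 2 * κ₁.factorization ℓ + 5 * Nat.log ℓ 163 + (if ℓ < 11 then 2 + B ℓ else 0)
    rw [if_neg h3]
    omega
  · -- `ℓ ≤ 7`: Lemma 6.10 at `L = ℓ³ ≥ 7`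
    have hℓ7 : 7 ≤ ℓ ^ 3 :=
      calc 7 ≤ 2 ^ 3 := by norm_num
        _ ≤ ℓ ^ 3 := Nat.pow_le_pow_left hℓ.two_le 3
    have hlt : ℓ < 11 := by omega
    have hΔ0 : W.minimalDiscriminantNorm ℤ ≠ 0 := (W.minimalDiscriminantNorm_pos_holds).ne'
    by_cases hex : W.minimalDiscriminantNorm ℤ ∈ {Δ : ℕ | ∃ (W : WeierstrassCurve ℚ) (_ : W.IsElliptic),
        (∀ q : ℕ, q.Prime → q ∉ S → ¬ q ^ 2 ∣ W.conductorNorm ℤ) ∧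
        W.minimalDiscriminantNorm ℤ = Δ ∧
        ∃ n k : ℕ, (∀ q : ℕ, q.Prime → q ∣ n → q ∈ S) ∧ Δ = n * k ^ (ℓ ^ 3)}
    · -- an exceptional curve: `v_ℓ(j_p) ≤ v_ℓ(c_p(A_{D,M})) ≤ log_ℓ 163 + v_ℓ(c_p(E))`, bounded
      rw [← hWN] at hpN hp2N
      obtain ⟨a, b, ha, ha', hb, hb', e⟩ := h68 W W' hPm.1 p hp hpN hp2N
      have hcpE := factorization_minimalDiscriminantNorm_pos_of_dvd W hp hpN
      have h1 := factorization_le_of_dvd_of_mul_eq_mul (hJc hadm X W hWN W' P hPm p hp hpD)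
        ha ha' hb hb' hcpE e ℓ
      have h2 : ((W.minimalDiscriminantNorm ℤ).factorization p).factorization ℓ ≤ B ℓ := by
        show _ ≤ (if h : 7 ≤ ℓ ^ 3 then (h610 (ℓ ^ 3) h).toFinset.sup id else 0)
        rw [dif_pos hℓ7]
        calc ((W.minimalDiscriminantNorm ℤ).factorization p).factorization ℓ
            ≤ (W.minimalDiscriminantNorm ℤ).factorization p := (Nat.factorization_lt ℓ hcpE.ne').le
          _ ≤ W.minimalDiscriminantNorm ℤ := (Nat.factorization_lt p hΔ0).le
          _ ≤ (h610 (ℓ ^ 3) hℓ7).toFinset.sup id :=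
            Finset.le_sup (f := id) ((h610 (ℓ ^ 3) hℓ7).mem_toFinset.mpr hex)
      show _ ≤ 2 * κ₁.factorization ℓ + 5 * Nat.log ℓ 163 + (if ℓ < 11 then 2 + B ℓ else 0)
      rw [if_pos hlt]
      omega
    · -- a generic curve: some prime `r ∉ S` has `ℓ³ ∤ c_r(E)`
      obtain ⟨r, hr, hrS, hr3⟩ : ∃ r : ℕ, r.Prime ∧ r ∉ S ∧
          ¬ ℓ ^ 3 ∣ (W.minimalDiscriminantNorm ℤ).factorization r := by
        by_contra hcon
        push Not at hcon
        obtain ⟨n, k, -, hnS, hnk⟩ := exists_eq_mul_pow_of_dvd_factorization S hΔ0 hcon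
        exact hex ⟨W, ‹W.IsElliptic›, fun q hq hqS => by rw [hWN]; exact hS q hq hqS, rfl,
          n, k, hnS, hnk⟩
      have hcr0 : (W.minimalDiscriminantNorm ℤ).factorization r ≠ 0 := fun h0 =>
        hr3 (h0 ▸ dvd_zero _)
      have hrN : r ∣ N := hWN ▸ dvd_conductorNorm_of_factorization_ne_zero W hcr0
      have hr2 : ¬ r ^ 2 ∣ N := hS r hr hrS
      have hT : ((W.minimalDiscriminantNorm ℤ).factorization r).factorization ℓ ≤ 2 := by
        by_contra h3
        exact hr3 ((pow_dvd_pow ℓ (by omega)).trans (Nat.ordProj_dvd _ ℓ))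
      have h1 := main r hr hrN hr2
      show _ ≤ 2 * κ₁.factorization ℓ + 5 * Nat.log ℓ 163 + (if ℓ < 11 then 2 + B ℓ else 0)
      rw [if_pos hlt]
      omega

/-! ### Lemma 6.14: the image bound, from the Eisenstein property and Lemma 6.7 -/

include hI in
/-- **Pasten 2024, Lemma 6.14 (bounding the image), performed in the tree.** Printed (p. 23): "Let
`S` be a finite set of primes. If `N = DM` is squarefree away from `S` and `p` exactly divides `M`,
then for every prime `ℓ` we have `v_ℓ(i_p(D,M)) ≤ β_S(ℓ) − 1` with `β_S(ℓ)` as in Lemma 6.7. In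
particular, if `N = DM` is squarefree away from `S`, and `p` exactly divides `M`, then
`i_p(J₀^D(M), χ_{D,M})` divides an integer `κ_S` which only depends on the set `S` and, moreover,
`κ_S` is supported on the primes `≤ 163`." Inputs, as hypotheses: (`hEis`) the conclusion of the
first half of the printed proof — "the group `Φ_p(J₀^D(M))` is Eisenstein … (cf. [RibetEisenstein]).
On the other hand, since `A_{D,M}` is the optimal quotient associated to `χ_{D,M}`, the action of
`T_r` on `J₀^D(M)` induces multiplication by `a_r(A_{D,M})` on `A_{D,M}` … It follows that
`i_p(J₀^D(M), χ_{D,M})` divides `r + 1 − a_r(A_{D,M})` for every prime `r ∤ N`" (`a_r(A_{D,M})` =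
the tree's `W'.LFunction r` of the curve of the class-minimal datum); (`h67`) Lemma 6.7 p. 22 — for
every prime `ℓ` an integer `β_S(ℓ)`, `= 1` for `ℓ > 163`, such that every `A/ℚ` semistable away from
`S` has infinitely many primes `r` with `a_r(A) ≢ r + 1 mod ℓ^{β_S(ℓ)}`. Proof as printed, applied to
`A = E` (which is semistable away from `S`; `a_r(E) = a_r(A_{D,M})` by the isogeny invariance of the
`L`-function, the tree's `LFunction_eq_of_isIsogenous_holds`, Knapp Thm. 11.67): a prime `r > N` with
`ℓ^{β} ∤ r + 1 − a_r` gives `v_ℓ(i_p) ≤ β − 1`, and `κ_S = ∏_{ℓ ≤ 163} ℓ^{β_S(ℓ) − 1}`.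
[cite: PastenShimura2024, Lemma 6.14 p. 23 (statement and proof), Lemma 6.7 p. 22] -/
theorem PastenShimura2024_lemma_6_14
    (hEis : ∀ {N D M : ℕ}, IsAdmissibleFactorization N D M →
      ∀ (X : ShimuraCurveData D M) (W : WeierstrassCurve ℚ) [W.IsElliptic] [W.IsGloballyMinimal],
        W.conductorNorm ℤ = N →
      ∀ (W' : WeierstrassCurve ℚ) [W'.IsElliptic] (P : ShimuraParametrizationData X W'),
        P.IsMinimalFor W → ∀ p : ℕ, p.Prime → p ∣ M → ¬ p ^ 2 ∣ M →
        ∀ r : ℕ, r.Prime → ¬ r ∣ N → (cI P p : ℤ) ∣ (r + 1 : ℤ) - W'.LFunction r)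
    (h67 : ∀ ℓ : ℕ, ℓ.Prime → ∃ β : ℕ, (163 < ℓ → β = 1) ∧
      ∀ (A : WeierstrassCurve ℚ) [A.IsElliptic],
        (∀ q : ℕ, q.Prime → q ∉ S → ¬ q ^ 2 ∣ A.conductorNorm ℤ) →
        ∀ r₀ : ℕ, ∃ r : ℕ, r₀ < r ∧ r.Prime ∧ ¬ ((ℓ ^ β : ℕ) : ℤ) ∣ (r + 1 : ℤ) - A.LFunction r) :
    ∃ κ₁ : ℕ, 1 ≤ κ₁ ∧ (∀ q ∈ κ₁.primeFactors, q ≤ 163) ∧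
      ∀ {N D M : ℕ}, IsAdmissibleFactorization N D M →
      ∀ (X : ShimuraCurveData D M) (W : WeierstrassCurve ℚ) [W.IsElliptic] [W.IsGloballyMinimal],
        W.conductorNorm ℤ = N → (∀ q : ℕ, q.Prime → q ∉ S → ¬ q ^ 2 ∣ N) →
      ∀ (W' : WeierstrassCurve ℚ) [W'.IsElliptic] (P : ShimuraParametrizationData X W'),
        P.IsMinimalFor W → ∀ p : ℕ, p.Prime → p ∣ M → ¬ p ^ 2 ∣ M → cI P p ∣ κ₁ := by
  classical
  choose β hβ1 hβ2 using h67
  let α : ℕ → ℕ := fun ℓ => if h : ℓ.Prime then β ℓ h - 1 else 0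
  have hα0 : ∀ ℓ : ℕ, ℓ.Prime → 164 ≤ ℓ → α ℓ = 0 := by
    intro ℓ hℓ h164
    show (if h : ℓ.Prime then β ℓ h - 1 else 0) = 0
    rw [dif_pos hℓ, hβ1 ℓ hℓ (by omega)]
  refine ⟨∏ ℓ ∈ (Finset.range 164).filter Nat.Prime, ℓ ^ α ℓ,
    (one_le_prod_pow_and_primeFactors_lt 164 α).1,
    fun q hq => Nat.lt_succ_iff.mp ((one_le_prod_pow_and_primeFactors_lt 164 α).2 q hq), ?_⟩
  intro N D M hadm X W _ _ hWN hS W' _ P hPm p hp hpM hp2M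
  refine dvd_prod_pow_of_factorization_le (hI P p).ne' (fun ℓ hℓ => ?_) hα0
  -- a prime `r > N` (so `r ∤ N`) with `a_r(E) ≢ r + 1 mod ℓ^β`
  obtain ⟨r, hrN, hr, hndvd⟩ :=
    hβ2 ℓ hℓ W (fun q hq hqS => by rw [hWN]; exact hS q hq hqS) N
  have hrN' : ¬ r ∣ N := fun h => absurd hrN (not_lt.mpr (Nat.le_of_dvd hadm.pos h))
  -- `a_r(A_{D,M}) = a_r(E)` (isogeny invariance), and the Eisenstein divisibility
  have hL : W'.LFunction = W.LFunction := (LFunction_eq_of_isIsogenous_holds W W' hPm.1).symm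
  have hdvd := hEis hadm X W hWN W' P hPm p hp hpM hp2M r hr hrN'
  rw [hL] at hdvd
  -- hence `v_ℓ(i_p) < β`
  have hlt : (cI P p).factorization ℓ < β ℓ hℓ := by
    by_contra hge
    push Not at hge
    exact hndvd ((Int.natCast_dvd_natCast.mpr
      ((pow_dvd_pow ℓ hge).trans (Nat.ordProj_dvd _ ℓ))).trans hdvd)
  show _ ≤ (if h : ℓ.Prime then β ℓ h - 1 else 0)
  rw [dif_pos hℓ]
  omega

/-! ## IV. Thm. 6.1 (b) and (b′) from the finer inputs -/

/-! ### The bounded two-prime step (EqSequentially) for part (b), in the generality of Thm. 6.17' -/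

include hI hJ h613 hJc h68 hκ₁ h614 in
/-- **(EqSequentially) with bounded denominator, in the generality of Thm. 6.17'** (§6.9 p. 25:
"`δ_{d,prm}/δ_{dpr,m} = u_{d,p,r,m}/(i_p(d,prm)² j_r(dpr,m)²) · c_p(E) c_r(E)` … Here one also uses
Lemma 6.14 on the factors `i_p(d,prm)²` … the cokernel factors `j_r(dpr,m)²` are controlled by
Theorem 6.17"): one constant `κ₀ = κ_S² κ₂² (163!)² ≥ 1` supported on primes `≤ 163` such that for
`E` semistable away from `S` with the Fermat input and `N = DM` admissible, `D = d·pr`, `M` without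
exactly one multiplicative prime, `δ_{d,prM} · b = a · δ_{D,M} · c_p(E) c_r(E)` with `b ∣ κ₀`
(Prop. 6.13 `h613`; `i_p(d,prM) ∣ κ_S` by Lemma 6.14 `h614`, `p ∥ prM`; `j_r(D,M) ∣ κ₂` by
Thm. 6.17'; Lemma 6.8 `h68` twice). [cite: PastenShimura2024, §6.9 p. 25 ((EqSequentially), items (a)/(b)), with Prop. 6.13 and Lemma 6.14 p. 23, Thm. 6.17 p. 24, Lemma 6.8 p. 22] -/
theorem twoPrimeStep_of_ribetTakahashi_inputs (hP : nonempty_shimuraParametrizationData)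
    (hκ₁' : ∀ q ∈ κ₁.primeFactors, q ≤ 163)
    (h610 : ∀ L : ℕ, 7 ≤ L → {Δ : ℕ | ∃ (W : WeierstrassCurve ℚ) (_ : W.IsElliptic),
        (∀ q : ℕ, q.Prime → q ∉ S → ¬ q ^ 2 ∣ W.conductorNorm ℤ) ∧
        W.minimalDiscriminantNorm ℤ = Δ ∧
        ∃ n k : ℕ, (∀ q : ℕ, q.Prime → q ∣ n → q ∈ S) ∧ Δ = n * k ^ L}.Finite) :
    ∃ κ₀ : ℕ, 1 ≤ κ₀ ∧ (∀ q ∈ κ₀.primeFactors, q ≤ 163) ∧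
      ∀ {N D M d p r : ℕ}, p.Prime → r.Prime → p ≠ r → D = d * (p * r) →
      IsAdmissibleFactorization N D M →
      ∀ (X₁ : ShimuraCurveData d (p * r * M)) (X₂ : ShimuraCurveData D M)
        (W : WeierstrassCurve ℚ) [W.IsElliptic] [W.IsGloballyMinimal], W.conductorNorm ℤ = N →
        (∀ q : ℕ, q.Prime → q ∉ S → ¬ q ^ 2 ∣ N) →
        (∀ ℓ : ℕ, ℓ.Prime → 11 ≤ ℓ → ∃ r : ℕ, r.Prime ∧ r ∣ N ∧ ¬ r ^ 2 ∣ N ∧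
          ¬ ℓ ∣ (W.minimalDiscriminantNorm ℤ).factorization r) →
        (M.primeFactors.filter fun t => ¬ t ^ 2 ∣ N).card ≠ 1 →
      ∀ (W₁' : WeierstrassCurve ℚ) [W₁'.IsElliptic] (P₁ : ShimuraParametrizationData X₁ W₁'),
        P₁.IsMinimalFor W →
      ∀ (W₂' : WeierstrassCurve ℚ) [W₂'.IsElliptic] (P₂ : ShimuraParametrizationData X₂ W₂'),
        P₂.IsMinimalFor W →
        ∃ a b : ℕ, 0 < a ∧ 0 < b ∧ b ∣ κ₀ ∧
          P₁.deg * b = a * P₂.deg *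
            ((W.minimalDiscriminantNorm ℤ).factorization p *
              (W.minimalDiscriminantNorm ℤ).factorization r) := by
  obtain ⟨κ₂, hκ₂, hκ₂', h617⟩ :=
    PastenShimura2024_thm_6_17' cI cJ hI hJ h613 hJc h68 hκ₁ h614 hP hκ₁' h610
  refine ⟨κ₁ ^ 2 * κ₂ ^ 2 * (Nat.factorial 163) ^ 2,
    Nat.one_le_iff_ne_zero.mpr (mul_ne_zero (mul_ne_zero (pow_ne_zero 2 hκ₁.ne')
      (pow_ne_zero 2 (by omega))) (pow_ne_zero 2 (Nat.factorial_pos 163).ne')),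
    primeFactors_le_of_kappa (Nat.one_le_iff_ne_zero.mpr hκ₁.ne') hκ₂ hκ₁' hκ₂', ?_⟩
  intro N D M d p r hp hr hpr hD hadm X₁ X₂ W _ _ hWN hS hF hM1 W₁' _ P₁ hP₁ W₂' _ P₂ hP₂
  -- `p, r ∥ N`; the level `(d, prM)` is admissible
  have hpD : p ∣ D := ⟨d * r, by rw [hD]; ring⟩
  have hrD : r ∣ D := ⟨d * p, by rw [hD]; ring⟩
  obtain ⟨hpN, hp2N⟩ := hadm.dvd_and_not_sq_dvd hp hpD
  obtain ⟨hrN, hr2N⟩ := hadm.dvd_and_not_sq_dvd hr hrD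
  obtain ⟨-, hadm₁, -, -⟩ := hadm.erase_two_primes hp hr hpr hpD hrD
  have hd : D / (p * r) = d := by rw [hD, Nat.mul_div_cancel _ (Nat.mul_pos hp.pos hr.pos)]
  rw [hd] at hadm₁
  obtain ⟨-, hp1, hp2⟩ := hadm.not_sq_dvd_mul_of_dvd hp hr hpr hpD
  -- `i = i_p(d,prM) ∣ κ_S` (Lemma 6.14), `j = j_r(D,M) ∣ κ₂` (Thm. 6.17'), Prop. 6.13, Lemma 6.8
  have hiκ : cI P₁ p ∣ κ₁ := h614 hadm₁ X₁ W hWN hS W₁' P₁ hP₁ p hp hp1 hp2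
  have hjκ : cJ P₂ r ∣ κ₂ := h617 hadm X₂ W hWN hS hF hM1 W₂' P₂ hP₂ r hr hrD
  have h13 := h613 hp hr hpr hD rfl hadm X₁ X₂ W hWN W₁' P₁ hP₁ W₂' P₂ hP₂
  rw [← hWN] at hpN hp2N hrN hr2N
  obtain ⟨a₁, b₁, ha₁, -, hb₁, hb₁le, h₁⟩ := h68 W W₁' hP₁.1 p hp hpN hp2N
  obtain ⟨a₂, b₂, ha₂, -, hb₂, hb₂le, h₂⟩ := h68 W W₂' hP₂.1 r hr hrN hr2N
  set i := cI P₁ p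
  set j := cJ P₂ r
  refine ⟨a₁ * a₂, i ^ 2 * j ^ 2 * (b₁ * b₂), Nat.mul_pos ha₁ ha₂,
    Nat.mul_pos (Nat.mul_pos (pow_pos (hI P₁ p) 2) (pow_pos (hJ P₂ r) 2)) (Nat.mul_pos hb₁ hb₂),
    ?_, ?_⟩
  · refine mul_dvd_mul (mul_dvd_mul (pow_dvd_pow_of_dvd hiκ 2) (pow_dvd_pow_of_dvd hjκ 2)) ?_
    rw [sq]
    exact mul_dvd_mul (Nat.dvd_factorial hb₁ hb₁le) (Nat.dvd_factorial hb₂ hb₂le)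
  · set c₁ := (W₁'.minimalDiscriminantNorm ℤ).factorization p
    set c₂ := (W₂'.minimalDiscriminantNorm ℤ).factorization r
    set vp := (W.minimalDiscriminantNorm ℤ).factorization p
    set vr := (W.minimalDiscriminantNorm ℤ).factorization r
    calc P₁.deg * (i ^ 2 * j ^ 2 * (b₁ * b₂)) = P₁.deg * (i ^ 2 * j ^ 2) * (b₁ * b₂) := by ring
      _ = P₂.deg * (c₁ * c₂) * (b₁ * b₂) := by rw [h13]
      _ = P₂.deg * ((c₁ * b₁) * (c₂ * b₂)) := by ring
      _ = P₂.deg * ((a₁ * vp) * (a₂ * vr)) := by rw [h₁, h₂]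
      _ = a₁ * a₂ * P₂.deg * (vp * vr) := by ring

/-! ### The telescoping of §6.9 for an arbitrary class stable under `M ↦ prM` -/

/-- **The telescoping of §6.9, for an arbitrary class of `(E, N, M)` stable under `M ↦ prM`**
(p. 25: "Repeated applications of this observation (to sequentially remove prime factors from `D`)
… choosing a prime factorization `D = p₁r₁⋯p_nr_n` we apply the previous analysis"): the landed
`PastenShimura2024_thm_6_1_b_of_eqSequentially` with the printed class (b.1)/(b.2) replaced by a
predicate `C E N M` inherited by the larger levels `prM` of the telescoping product (hypothesis
`hC`). From the bounded two-prime step in the class (`hstep`, `b ∣ κ₀`), the `D = 1` bridge in the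
class (`h0`) and the existence of curves and Jacquet–Langlands data (`hX`, `hP`):
`δ_{1,N} · b = a · δ_{D,M} · ∏_{p ∣ D} v_p(Δ_E)` with `b ∣ κ₀^{ω(D)}`, by induction on `ω(D)/2`.
[cite: PastenShimura2024, §6.9 p. 25 (proof of Thm. 6.1, telescoping)] -/
theorem denominator_dvd_pow_of_twoPrimeStep (C : WeierstrassCurve ℚ → ℕ → ℕ → Prop)
    (hC : ∀ (W : WeierstrassCurve ℚ) {N D M d p r : ℕ}, p.Prime → r.Prime → p ≠ r →
      D = d * (p * r) → IsAdmissibleFactorization N D M → C W N M → C W N (p * r * M))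
    (hX : nonempty_shimuraCurveData) (hP : nonempty_shimuraParametrizationData) {κ₀ : ℕ}
    (h0 : ∀ {N : ℕ} [NeZero N] (X : ShimuraCurveData 1 N) (W : WeierstrassCurve ℚ) [W.IsElliptic]
      [W.IsGloballyMinimal], W.conductorNorm ℤ = N → C W N N →
      ∀ (W₁ : WeierstrassCurve ℚ) [W₁.IsElliptic] (D₁ : ModularParametrizationData W₁ N),
        IsNewformOf W D₁.f →
        (∀ (W₂ : WeierstrassCurve ℚ) [W₂.IsElliptic] (D₂ : ModularParametrizationData W₂ N),
            D₂.f = D₁.f → D₁.modularDegree ≤ D₂.modularDegree) →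
      ∀ (W' : WeierstrassCurve ℚ) [W'.IsElliptic] (P : ShimuraParametrizationData X W'),
        P.IsMinimalFor W → P.deg ∣ D₁.modularDegree)
    (hstep : ∀ {N D M d p r : ℕ}, p.Prime → r.Prime → p ≠ r → D = d * (p * r) →
      IsAdmissibleFactorization N D M →
      ∀ (X₁ : ShimuraCurveData d (p * r * M)) (X₂ : ShimuraCurveData D M)
        (W : WeierstrassCurve ℚ) [W.IsElliptic] [W.IsGloballyMinimal], W.conductorNorm ℤ = N →
        C W N M →
      ∀ (W₁' : WeierstrassCurve ℚ) [W₁'.IsElliptic] (P₁ : ShimuraParametrizationData X₁ W₁'),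
        P₁.IsMinimalFor W →
      ∀ (W₂' : WeierstrassCurve ℚ) [W₂'.IsElliptic] (P₂ : ShimuraParametrizationData X₂ W₂'),
        P₂.IsMinimalFor W →
        ∃ a b : ℕ, 0 < a ∧ 0 < b ∧ b ∣ κ₀ ∧
          P₁.deg * b = a * P₂.deg *
            ((W.minimalDiscriminantNorm ℤ).factorization p *
              (W.minimalDiscriminantNorm ℤ).factorization r))
    {N D M : ℕ} [NeZero N] (hadm : IsAdmissibleFactorization N D M) (X : ShimuraCurveData D M)
    (W : WeierstrassCurve ℚ) [W.IsElliptic] [W.IsGloballyMinimal] (hWN : W.conductorNorm ℤ = N)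
    (hcl : C W N M) (W₁ : WeierstrassCurve ℚ) [W₁.IsElliptic] (D₁ : ModularParametrizationData W₁ N)
    (hf : IsNewformOf W D₁.f)
    (hmin : ∀ (W₂ : WeierstrassCurve ℚ) [W₂.IsElliptic] (D₂ : ModularParametrizationData W₂ N),
      D₂.f = D₁.f → D₁.modularDegree ≤ D₂.modularDegree)
    (W' : WeierstrassCurve ℚ) [W'.IsElliptic] (P : ShimuraParametrizationData X W')
    (hPmin : P.IsMinimalFor W) :
    ∃ a b : ℕ, 0 < a ∧ 0 < b ∧ b ∣ κ₀ ^ D.primeFactors.card ∧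
      D₁.modularDegree * b =
        a * P.deg * ∏ p ∈ D.primeFactors, (W.minimalDiscriminantNorm ℤ).factorization p := by
  obtain ⟨n, hn⟩ := hadm.even_card_primeFactors
  induction n generalizing D M W' with
  | zero =>
    -- `D = 1`, `M = N`: `deg P ∣ δ_{1,N}` (`h0`), take `b = 1`
    have hD : D = 1 := by
      have h1 := Nat.primeFactors_eq_empty.mp (Finset.card_eq_zero.mp hn)
      exact h1.resolve_left hadm.squarefree.ne_zero
    subst hD
    obtain rfl : M = N := by simpa using hadm.mul_eq
    obtain ⟨a, ha⟩ := h0 X W hWN hcl W₁ D₁ hf hmin W' P hPmin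
    refine ⟨a, 1, Nat.pos_of_ne_zero ?_, Nat.one_pos, one_dvd _, ?_⟩
    · rintro rfl
      exact D₁.deg_pos.ne' (by simpa [ModularParametrizationData.modularDegree] using ha)
    · simp [ha, mul_comm]
  | succ n ih =>
    -- two primes `p ≠ r` of `D`, `d = D/(pr)`
    obtain ⟨p, hp⟩ : D.primeFactors.Nonempty := Finset.card_pos.mp (by omega)
    obtain ⟨r, hr⟩ : (D.primeFactors.erase p).Nonempty :=
      Finset.card_pos.mp (by rw [Finset.card_erase_of_mem hp]; omega)
    obtain ⟨hrp, hr⟩ := Finset.mem_erase.mp hr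
    have hpp : p.Prime := Nat.prime_of_mem_primeFactors hp
    have hrr : r.Prime := Nat.prime_of_mem_primeFactors hr
    obtain ⟨hDd, hadm₁, hdisj, hpf⟩ :=
      hadm.erase_two_primes hpp hrr (Ne.symm hrp) (Nat.dvd_of_mem_primeFactors hp)
        (Nat.dvd_of_mem_primeFactors hr)
    set d := D / (p * r) with hd
    have hcard : D.primeFactors.card = d.primeFactors.card + 2 := by
      rw [hpf, Finset.card_union_of_disjoint hdisj, Finset.card_pair (Ne.symm hrp)]
    -- the curve `X₀^d(prM)` and a datum realising `δ_{d,prM}`; the class passes to `prM`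
    obtain ⟨X₁⟩ := hX hadm₁
    obtain ⟨W₁', hW₁', P₁, hP₁min⟩ :=
      ShimuraParametrizationData.exists_isMinimalFor_of_nonempty (hP hadm₁ X₁ W hWN)
    have hcl₁ : C W N (p * r * M) := hC W hpp hrr (Ne.symm hrp) hDd hadm hcl
    -- induction hypothesis at level `(d, prM)` and the bounded two-prime step
    obtain ⟨a₁, b₁, ha₁, hb₁, hb₁d, h₁⟩ := ih hadm₁ X₁ hcl₁ W₁' P₁ hP₁min (by omega)
    obtain ⟨a₂, b₂, ha₂, hb₂, hb₂d, h₂⟩ :=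
      hstep hpp hrr (Ne.symm hrp) hDd hadm X₁ X W hWN hcl W₁' P₁ hP₁min W' P hPmin
    refine ⟨a₁ * a₂, b₁ * b₂, Nat.mul_pos ha₁ ha₂, Nat.mul_pos hb₁ hb₂, ?_, ?_⟩
    · rw [hcard, pow_add]
      exact mul_dvd_mul hb₁d (hb₂d.trans (dvd_pow_self κ₀ two_ne_zero))
    · rw [hpf, Finset.prod_union hdisj, Finset.prod_pair (Ne.symm hrp)]
      set V := ∏ q ∈ d.primeFactors, (W.minimalDiscriminantNorm ℤ).factorization q
      set vp := (W.minimalDiscriminantNorm ℤ).factorization p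
      set vr := (W.minimalDiscriminantNorm ℤ).factorization r
      calc D₁.modularDegree * (b₁ * b₂) = D₁.modularDegree * b₁ * b₂ := by ring
        _ = a₁ * P₁.deg * V * b₂ := by rw [h₁]
        _ = a₁ * V * (P₁.deg * b₂) := by ring
        _ = a₁ * V * (a₂ * P.deg * (vp * vr)) := by rw [h₂]
        _ = a₁ * a₂ * P.deg * (V * (vp * vr)) := by ring

/-! ### Thm. 6.1 (b′): the conclusion of Thm. 6.1 (b) in the generality of its proof -/

include hI hJ h613 hJc h68 hκ₁ h614 in
/-- **Pasten 2024, "Thm. 6.1 (b′)" — the conclusion of Thm. 6.1 (b) for every curve to which its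
printed proof applies.** For a finite set of primes `S` (with `κ_S` of Lemma 6.14, `h614`, and the
exceptional sets of Lemma 6.10, `h610`) there is `κ ≥ 1` supported on primes `≤ 163` such that: for
every `E` (a globally minimal `W`) of conductor `N`, semistable away from `S`, satisfying the Fermat
input ("for every prime `ℓ ≥ 11` some multiplicative prime `r ∣ N` has `ℓ ∤ v_r(Δ_E)`" — for
semistable `E` this is Lemma 6.11, for Frey–Hellegouarch `E` Lemma 6.12), every admissible `N = DM`
whose `M` does not have exactly one multiplicative prime, every class-minimal classical datum `D₁`
with the newform of `W` and every datum `P` realising `δ_{D,M}`: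
`δ_{1,N} · b = a · δ_{D,M} · ∏_{p ∣ D} v_p(Δ_E)` with `b ∣ κ^{ω(D)}` — i.e. the denominator of
`γ_{D,M,E}` divides `κ^{ω(D)}`. This is Pasten's proof of Thm. 6.1 (b) (§6.9 with Prop. 6.13,
Lemmas 6.8, 6.14–6.16, Thm. 6.17) run in the generality in which it is written (the summit-side line
`jl-zero-cycle-height` records: "on the rest of the class the inequality is Pasten's PROOF of
Thm 6.17 run with `S = {2}` and the Fermat input as hypothesis"); inputs `h613`, `hJc`, `h614`,
`h68`, `h610`, the Jacquet–Langlands fact `hP` and the `D = 1` bridge `h0` (here class-free: the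
class-minimal degree of Shimura data on a `ShimuraCurveData 1 N` divides `δ_{1,N}`, §2 p. 12,
`J₀^1(N) = J₀(N)`). [cite: PastenShimura2024, Thm. 6.1 (b) p. 20 and its proof §6.9 p. 25, Thm. 6.17 p. 24 (proof)] -/
theorem PastenShimura2024_thm_6_1_b' (hP : nonempty_shimuraParametrizationData)
    (h0 : ∀ {N : ℕ} [NeZero N] (X : ShimuraCurveData 1 N) (W : WeierstrassCurve ℚ) [W.IsElliptic]
      [W.IsGloballyMinimal], W.conductorNorm ℤ = N →
      ∀ (W₁ : WeierstrassCurve ℚ) [W₁.IsElliptic] (D₁ : ModularParametrizationData W₁ N),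
        IsNewformOf W D₁.f →
        (∀ (W₂ : WeierstrassCurve ℚ) [W₂.IsElliptic] (D₂ : ModularParametrizationData W₂ N),
            D₂.f = D₁.f → D₁.modularDegree ≤ D₂.modularDegree) →
      ∀ (W' : WeierstrassCurve ℚ) [W'.IsElliptic] (P : ShimuraParametrizationData X W'),
        P.IsMinimalFor W → P.deg ∣ D₁.modularDegree)
    (hκ₁' : ∀ q ∈ κ₁.primeFactors, q ≤ 163)
    (h610 : ∀ L : ℕ, 7 ≤ L → {Δ : ℕ | ∃ (W : WeierstrassCurve ℚ) (_ : W.IsElliptic),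
        (∀ q : ℕ, q.Prime → q ∉ S → ¬ q ^ 2 ∣ W.conductorNorm ℤ) ∧
        W.minimalDiscriminantNorm ℤ = Δ ∧
        ∃ n k : ℕ, (∀ q : ℕ, q.Prime → q ∣ n → q ∈ S) ∧ Δ = n * k ^ L}.Finite) :
    ∃ κ : ℕ, 1 ≤ κ ∧ (∀ q ∈ κ.primeFactors, q ≤ 163) ∧
      ∀ {N D M : ℕ} [NeZero N], IsAdmissibleFactorization N D M →
      ∀ (X : ShimuraCurveData D M) (W : WeierstrassCurve ℚ) [W.IsElliptic] [W.IsGloballyMinimal],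
        W.conductorNorm ℤ = N → (∀ q : ℕ, q.Prime → q ∉ S → ¬ q ^ 2 ∣ N) →
        (∀ ℓ : ℕ, ℓ.Prime → 11 ≤ ℓ → ∃ r : ℕ, r.Prime ∧ r ∣ N ∧ ¬ r ^ 2 ∣ N ∧
          ¬ ℓ ∣ (W.minimalDiscriminantNorm ℤ).factorization r) →
        (M.primeFactors.filter fun t => ¬ t ^ 2 ∣ N).card ≠ 1 →
      ∀ (W₁ : WeierstrassCurve ℚ) [W₁.IsElliptic] (D₁ : ModularParametrizationData W₁ N),
        IsNewformOf W D₁.f →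
        (∀ (W₂ : WeierstrassCurve ℚ) [W₂.IsElliptic] (D₂ : ModularParametrizationData W₂ N),
            D₂.f = D₁.f → D₁.modularDegree ≤ D₂.modularDegree) →
      ∀ (W' : WeierstrassCurve ℚ) [W'.IsElliptic] (P : ShimuraParametrizationData X W'),
        P.IsMinimalFor W →
        ∃ a b : ℕ, 0 < a ∧ 0 < b ∧ b ∣ κ ^ D.primeFactors.card ∧
          D₁.modularDegree * b =
            a * P.deg * ∏ p ∈ D.primeFactors, (W.minimalDiscriminantNorm ℤ).factorization p := by
  obtain ⟨κ₀, hκ₀, hκ₀', hstep⟩ :=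
    twoPrimeStep_of_ribetTakahashi_inputs cI cJ hI hJ h613 hJc h68 hκ₁ h614 hP hκ₁' h610
  refine ⟨κ₀, hκ₀, hκ₀', ?_⟩
  intro N D M _ hadm X W _ _ hWN hS hF hM1 W₁ _ D₁ hf hmin W' _ P hPmin
  -- the class: semistable away from `S`, Fermat input, `M` without exactly one multiplicative prime
  let C : WeierstrassCurve ℚ → ℕ → ℕ → Prop := fun W N M =>
    (∀ q : ℕ, q.Prime → q ∉ S → ¬ q ^ 2 ∣ N) ∧
    (∀ ℓ : ℕ, ℓ.Prime → 11 ≤ ℓ → ∃ r : ℕ, r.Prime ∧ r ∣ N ∧ ¬ r ^ 2 ∣ N ∧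
      ¬ ℓ ∣ (W.minimalDiscriminantNorm ℤ).factorization r) ∧
    (M.primeFactors.filter fun t => ¬ t ^ 2 ∣ N).card ≠ 1
  have hC : ∀ (W : WeierstrassCurve ℚ) {N D M d p r : ℕ}, p.Prime → r.Prime → p ≠ r →
      D = d * (p * r) → IsAdmissibleFactorization N D M → C W N M → C W N (p * r * M) := by
    rintro W N D M d p r hp hr hpr hD hadm ⟨h1, h2, -⟩
    refine ⟨h1, h2, ?_⟩
    -- `p, r` are two multiplicative primes of `prM`
    obtain ⟨-, hp2N⟩ := hadm.dvd_and_not_sq_dvd hp ⟨d * r, by rw [hD]; ring⟩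
    obtain ⟨-, hr2N⟩ := hadm.dvd_and_not_sq_dvd hr ⟨d * p, by rw [hD]; ring⟩
    have hne : p * r * M ≠ 0 := mul_ne_zero (mul_ne_zero hp.ne_zero hr.ne_zero) hadm.pos_right.ne'
    have hpm : p ∈ (p * r * M).primeFactors.filter fun t => ¬ t ^ 2 ∣ N :=
      Finset.mem_filter.mpr ⟨Nat.mem_primeFactors.mpr ⟨hp, ⟨r * M, by ring⟩, hne⟩, hp2N⟩
    have hrm : r ∈ (p * r * M).primeFactors.filter fun t => ¬ t ^ 2 ∣ N :=
      Finset.mem_filter.mpr ⟨Nat.mem_primeFactors.mpr ⟨hr, ⟨p * M, by ring⟩, hne⟩, hr2N⟩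
    have h2 : 2 ≤ ((p * r * M).primeFactors.filter fun t => ¬ t ^ 2 ∣ N).card := by
      calc 2 = ({p, r} : Finset ℕ).card := (Finset.card_pair hpr).symm
        _ ≤ _ := Finset.card_le_card (Finset.insert_subset_iff.mpr
          ⟨hpm, Finset.singleton_subset_iff.mpr hrm⟩)
    omega
  exact denominator_dvd_pow_of_twoPrimeStep C hC nonempty_shimuraCurveData_holds hP
    (fun X W _ _ hWN _ W₁ _ D₁ hf hmin W' _ P hPm => h0 X W hWN W₁ D₁ hf hmin W' P hPm)
    (fun hp hr hpr hD hadm X₁ X₂ W _ _ hWN hcl W₁' _ P₁ hP₁ W₂' _ P₂ hP₂ =>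
      hstep hp hr hpr hD hadm X₁ X₂ W hWN hcl.1 hcl.2.1 hcl.2.2 W₁' P₁ hP₁ W₂' P₂ hP₂)
    hadm X W hWN ⟨hS, hF, hM1⟩ W₁ D₁ hf hmin W' P hPmin

/-! ### Thm. 6.1 (b) (the named fact) from the finer inputs -/

include hI hJ h613 hJc h68 hκ₁ h614 in
/-- **Pasten 2024, Thm. 6.1 (b) from Prop. 6.13, `j ∣ #Φ`, Lemma 6.14, Lemma 6.8, Lemma 6.10,
Lemma 6.11, Lemma 6.12, the Jacquet–Langlands fact and the `D = 1` bridge** — the printed proof of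
part (b) with Pasten's §6.7–6.8 (Lemmas 6.15, 6.16, Thm. 6.17) PERFORMED in the tree: the landed
telescoping `PastenShimura2024_thm_6_1_b_of_prop_6_13_bounded_of_lemma_6_8` is fed with `h613b`
built from Prop. 6.13 (`h613`), `i_p(d,prM) ∣ κ_S` (Lemma 6.14, `h614`, at a set `S ∋ 2`: both
printed classes are semistable away from `2`, `not_sq_dvd_conductorNorm_of_isSemistable` /
`…_of_isFreyHellegouarch`) and `j_r(D,M) ∣ κ₂` (Thm. 6.17', whose Fermat input is Lemma 6.11 `h611`
in class (b.1) — `fermatInput_of_isSemistable` — and Lemma 6.12 `h612` in class (b.2) —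
`fermatInput_of_isFreyHellegouarch`, `(a,b,c) ≠ (1,1,2)` because `M` has an odd prime; and whose
condition on `M` holds: (b.1) `M ∣ N` is squarefree and not prime, so it has `≠ 1` prime factors,
all multiplicative; (b.2) the `≥ 2` odd primes of `M` are multiplicative). Hypotheses `h611`, `h612`
are Lemmas 6.11/6.12 as printed, in the renderings `|Δ_min| ≠ k^ℓ` (`k ≥ 2`; the summit-side
`fermatInputKnown_of_inputs`) and `odd part of |Δ_min| ≠ k^ℓ`; `h610` is Lemma 6.10 (finiteness of
the exceptional `|Δ_min|`); `h68` Lemma 6.8; `hP`, `h0` as in the sibling files.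
[cite: PastenShimura2024, Thm. 6.1 (b) p. 20, proof §6.9 p. 25, Prop. 6.13 and Lemma 6.14 p. 23, Thm. 6.17 p. 24, Lemmas 6.10–6.12 p. 23, Lemma 6.8 p. 22] -/
theorem PastenShimura2024_thm_6_1_b_of_ribetTakahashi_inputs
    (hP : nonempty_shimuraParametrizationData)
    (h0 : ∀ {N : ℕ} [NeZero N] (X : ShimuraCurveData 1 N) (W : WeierstrassCurve ℚ) [W.IsElliptic]
      [W.IsGloballyMinimal], W.conductorNorm ℤ = N →
      (W.IsSemistable ℤ ∧ ¬ N.Prime) ∨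
        (IsFreyHellegouarch W ∧ 2 ≤ (N.primeFactors.erase 2).card) →
      ∀ (W₁ : WeierstrassCurve ℚ) [W₁.IsElliptic] (D₁ : ModularParametrizationData W₁ N),
        IsNewformOf W D₁.f →
        (∀ (W₂ : WeierstrassCurve ℚ) [W₂.IsElliptic] (D₂ : ModularParametrizationData W₂ N),
            D₂.f = D₁.f → D₁.modularDegree ≤ D₂.modularDegree) →
      ∀ (W' : WeierstrassCurve ℚ) [W'.IsElliptic] (P : ShimuraParametrizationData X W'),
        P.IsMinimalFor W → P.deg ∣ D₁.modularDegree)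
    (hκ₁' : ∀ q ∈ κ₁.primeFactors, q ≤ 163) (h2S : 2 ∈ S)
    (h610 : ∀ L : ℕ, 7 ≤ L → {Δ : ℕ | ∃ (W : WeierstrassCurve ℚ) (_ : W.IsElliptic),
        (∀ q : ℕ, q.Prime → q ∉ S → ¬ q ^ 2 ∣ W.conductorNorm ℤ) ∧
        W.minimalDiscriminantNorm ℤ = Δ ∧
        ∃ n k : ℕ, (∀ q : ℕ, q.Prime → q ∣ n → q ∈ S) ∧ Δ = n * k ^ L}.Finite)
    (h611 : ∀ ℓ : ℕ, ℓ.Prime → 11 ≤ ℓ → ∀ (W : WeierstrassCurve ℚ) [W.IsElliptic],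
      W.IsSemistable ℤ → ∀ k : ℕ, 2 ≤ k → W.minimalDiscriminantNorm ℤ ≠ k ^ ℓ)
    (h612 : ∀ (W : WeierstrassCurve ℚ) [W.IsElliptic], IsFreyHellegouarch W →
      (∃ q : ℕ, q.Prime ∧ q ≠ 2 ∧ q ∣ W.conductorNorm ℤ) →
      ∀ ℓ : ℕ, ℓ.Prime → 3 ≤ ℓ → ∀ k : ℕ, ordCompl[2] (W.minimalDiscriminantNorm ℤ) ≠ k ^ ℓ) :
    PastenShimura2024_thm_6_1_b := by
  obtain ⟨κ₂, hκ₂, hκ₂', h617⟩ :=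
    PastenShimura2024_thm_6_17' cI cJ hI hJ h613 hJc h68 hκ₁ h614 hP hκ₁' h610
  refine PastenShimura2024_thm_6_1_b_of_prop_6_13_bounded_of_lemma_6_8
    nonempty_shimuraCurveData_holds hP h0 (Nat.one_le_iff_ne_zero.mpr hκ₁.ne') hκ₂ hκ₁' hκ₂' ?_ h68
  intro N D M d p r hp hr hpr hD hadm X₁ X₂ W _ _ hWN hcl W₁' _ P₁ hP₁ W₂' _ P₂ hP₂
  -- both classes are semistable away from `S ∋ 2`
  have hS : ∀ q : ℕ, q.Prime → q ∉ S → ¬ q ^ 2 ∣ N := by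
    intro q hq hqS
    have hq2 : q ≠ 2 := fun h => hqS (h ▸ h2S)
    rw [← hWN]
    rcases hcl with ⟨hss, -⟩ | ⟨hFH, -⟩
    · exact not_sq_dvd_conductorNorm_of_isSemistable W hss hq
    · exact not_sq_dvd_conductorNorm_of_isFreyHellegouarch hFH hq hq2
  -- `i_p(d,prM) ∣ κ_S` (Lemma 6.14 at the admissible level `(d, prM)`, `p ∥ prM`)
  have hpD : p ∣ D := ⟨d * r, by rw [hD]; ring⟩
  have hrD : r ∣ D := ⟨d * p, by rw [hD]; ring⟩
  obtain ⟨-, hadm₁, -, -⟩ := hadm.erase_two_primes hp hr hpr hpD hrD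
  have hd : D / (p * r) = d := by rw [hD, Nat.mul_div_cancel _ (Nat.mul_pos hp.pos hr.pos)]
  rw [hd] at hadm₁
  obtain ⟨-, hp1, hp2⟩ := hadm.not_sq_dvd_mul_of_dvd hp hr hpr hpD
  have hiκ : cI P₁ p ∣ κ₁ := h614 hadm₁ X₁ W hWN hS W₁' P₁ hP₁ p hp hp1 hp2
  -- the Fermat input (Lemma 6.11, resp. 6.12) and the condition on `M`, in the two classes
  have hN1 : N ≠ 1 := fun h1 =>
    hp.one_lt.ne' (Nat.dvd_one.mp (h1 ▸ (hadm.dvd_and_not_sq_dvd hp hpD).1))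
  have hF : ∀ ℓ : ℕ, ℓ.Prime → 11 ≤ ℓ → ∃ r : ℕ, r.Prime ∧ r ∣ N ∧ ¬ r ^ 2 ∣ N ∧
      ¬ ℓ ∣ (W.minimalDiscriminantNorm ℤ).factorization r := by
    intro ℓ hℓ h11
    rw [← hWN]
    rcases hcl with ⟨hss, -⟩ | ⟨hFH, hM2⟩
    · exact fermatInput_of_isSemistable W hss (hWN.symm ▸ hN1) (h611 ℓ hℓ h11 W hss)
    · have hodd : ∃ q : ℕ, q.Prime ∧ q ≠ 2 ∧ q ∣ W.conductorNorm ℤ := by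
        obtain ⟨q, hq⟩ : (M.primeFactors.erase 2).Nonempty := Finset.card_pos.mp (by omega)
        obtain ⟨hq2, hq⟩ := Finset.mem_erase.mp hq
        refine ⟨q, Nat.prime_of_mem_primeFactors hq, hq2, ?_⟩
        rw [hWN, ← hadm.mul_eq]
        exact Dvd.dvd.mul_left (Nat.dvd_of_mem_primeFactors hq) D
      exact fermatInput_of_isFreyHellegouarch W hFH (h612 W hFH hodd ℓ hℓ (by omega))
  have hM1 : (M.primeFactors.filter fun t => ¬ t ^ 2 ∣ N).card ≠ 1 := by
    rcases hcl with ⟨hss, hMp⟩ | ⟨hFH, hM2⟩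
    · -- (b.1): all primes of `M` are multiplicative; `M` is squarefree and not prime
      have hfilt : (M.primeFactors.filter fun t => ¬ t ^ 2 ∣ N) = M.primeFactors :=
        Finset.filter_true_of_mem fun t ht => by
          rw [← hWN]
          exact not_sq_dvd_conductorNorm_of_isSemistable W hss (Nat.prime_of_mem_primeFactors ht)
      rw [hfilt]
      intro h1
      obtain ⟨t, ht⟩ := Finset.card_eq_one.mp h1
      have hsqN : Squarefree N := hWN ▸ (W.isSemistable_iff_squarefree_conductorNorm).mp hss
      have hsqM : Squarefree M :=
        Squarefree.squarefree_of_dvd ⟨D, by rw [← hadm.mul_eq, mul_comm]⟩ hsqN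
      have hM : M = t := by
        rw [← Nat.prod_primeFactors_of_squarefree hsqM, ht, Finset.prod_singleton]
      have htp : t.Prime := Nat.prime_of_mem_primeFactors (ht ▸ Finset.mem_singleton_self t)
      exact hMp (hM ▸ htp)
    · -- (b.2): the `≥ 2` odd primes of `M` are multiplicative
      have hsub : M.primeFactors.erase 2 ⊆ M.primeFactors.filter fun t => ¬ t ^ 2 ∣ N := by
        intro t ht
        obtain ⟨ht2, ht⟩ := Finset.mem_erase.mp ht
        refine Finset.mem_filter.mpr ⟨ht, ?_⟩
        rw [← hWN]
        exact not_sq_dvd_conductorNorm_of_isFreyHellegouarch hFH (Nat.prime_of_mem_primeFactors ht) ht2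
      have := Finset.card_le_card hsub
      omega
  exact ⟨cI P₁ p, cJ P₂ r, hI P₁ p, hJ P₂ r, hiκ, h617 hadm X₂ W hWN hS hF hM1 W₂' P₂ hP₂ r hr hrD,
    h613 hp hr hpr hD rfl hadm X₁ X₂ W hWN W₁' P₁ hP₁ W₂' P₂ hP₂⟩

end RTSystem

/-! ### Thm. 6.1 (b) over the tree's facts: the exact list of external inputs -/

/-- **Pasten 2024, Thm. 6.1 (b) from Ribet–Takahashi's Prop. 6.13, the Eisenstein property of
`Φ_p(J₀^D(M))`, Lemma 6.7, `j ∣ #Φ`, Mazur–Kenku, Lemmas 6.10–6.12, Jacquet–Langlands and the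
`D = 1` bridge** — `PastenShimura2024_thm_6_1_b_of_ribetTakahashi_inputs` with Lemma 6.14 PROVED
from the Eisenstein divisibility `hEis` and Lemma 6.7 `h67` (`PastenShimura2024_lemma_6_14`, at any
finite `S ∋ 2`), and Lemma 6.8 PROVED from the tree's named fact `mazurKenku_exists_cyclic_isogeny`
(Mazur 1978 Thm. 1, Kenku 1982; `PastenShimura2024_lemma_6_8_of_mazurKenku'`,
`lemma_6_8_factorization_form`). So after this file the discharge `PastenShimura2024_thm_6_1_b_holds`
waits exactly for: (1) the vocabulary of Néron models / component groups `Φ_p` of `J₀^D(M)` and of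
the optimal quotient `q_{D,M}` defining `cI`, `cJ`, and over it the four geometric statements `h613`
(Ribet–Takahashi 1997, Thm. 2), `hEis` (Ribet: `Φ_p(J₀^D(M))` is Eisenstein, with the optimality of
`A_{D,M}`), `h67` (Pasten's Lemma 6.7: Mazur, Ribet, Faltings, Chebotarev), `hJc` (a cokernel into
a cyclic group of order `c` has order dividing `c`); (2) the Diophantine theorems `h610`
(Darmon–Granville), `h611` (level-lowering, Wiles), `h612` (Wiles, Ribet 1997, Darmon–Merel);
(3) the tree's named facts `mazurKenku_exists_cyclic_isogeny` and
`nonempty_shimuraParametrizationData`; (4) the `D = 1` bridge `h0` (which the fact gives back,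
`deg_dvd_of_PastenShimura2024_thm_6_1_b`). Pasten's own §6.6–6.9 is no longer among them.
[cite: PastenShimura2024, Thm. 6.1 (b) p. 20, §6.3–6.9 pp. 21–25] [cite: RibetTakahashi1997, Thm. 2] [cite: Mazur1978, Thm. 1] [cite: Kenku1982] -/
theorem PastenShimura2024_thm_6_1_b_of_ribetTakahashi_eisenstein_mazurKenku
    (hMK : mazurKenku_exists_cyclic_isogeny) (hP : nonempty_shimuraParametrizationData)
    (h0 : ∀ {N : ℕ} [NeZero N] (X : ShimuraCurveData 1 N) (W : WeierstrassCurve ℚ) [W.IsElliptic]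
      [W.IsGloballyMinimal], W.conductorNorm ℤ = N →
      (W.IsSemistable ℤ ∧ ¬ N.Prime) ∨
        (IsFreyHellegouarch W ∧ 2 ≤ (N.primeFactors.erase 2).card) →
      ∀ (W₁ : WeierstrassCurve ℚ) [W₁.IsElliptic] (D₁ : ModularParametrizationData W₁ N),
        IsNewformOf W D₁.f →
        (∀ (W₂ : WeierstrassCurve ℚ) [W₂.IsElliptic] (D₂ : ModularParametrizationData W₂ N),
            D₂.f = D₁.f → D₁.modularDegree ≤ D₂.modularDegree) →
      ∀ (W' : WeierstrassCurve ℚ) [W'.IsElliptic] (P : ShimuraParametrizationData X W'),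
        P.IsMinimalFor W → P.deg ∣ D₁.modularDegree)
    (cI cJ : ∀ {D M : ℕ} {X : ShimuraCurveData D M} {W' : WeierstrassCurve ℚ},
      ShimuraParametrizationData X W' → ℕ → ℕ)
    (hI : ∀ {D M : ℕ} {X : ShimuraCurveData D M} {W' : WeierstrassCurve ℚ}
      (P : ShimuraParametrizationData X W') (p : ℕ), 0 < cI P p)
    (hJ : ∀ {D M : ℕ} {X : ShimuraCurveData D M} {W' : WeierstrassCurve ℚ}
      (P : ShimuraParametrizationData X W') (p : ℕ), 0 < cJ P p)
    (h613 : ∀ {N d M₁ D M p r : ℕ}, p.Prime → r.Prime → p ≠ r → D = d * (p * r) →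
      M₁ = p * r * M → IsAdmissibleFactorization N D M →
      ∀ (X₁ : ShimuraCurveData d M₁) (X₂ : ShimuraCurveData D M)
        (W : WeierstrassCurve ℚ) [W.IsElliptic] [W.IsGloballyMinimal], W.conductorNorm ℤ = N →
      ∀ (W₁' : WeierstrassCurve ℚ) [W₁'.IsElliptic] (P₁ : ShimuraParametrizationData X₁ W₁'),
        P₁.IsMinimalFor W →
      ∀ (W₂' : WeierstrassCurve ℚ) [W₂'.IsElliptic] (P₂ : ShimuraParametrizationData X₂ W₂'),
        P₂.IsMinimalFor W →
        P₁.deg * (cI P₁ p ^ 2 * cJ P₂ r ^ 2) =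
          P₂.deg * ((W₁'.minimalDiscriminantNorm ℤ).factorization p *
            (W₂'.minimalDiscriminantNorm ℤ).factorization r))
    (hJc : ∀ {N D M : ℕ}, IsAdmissibleFactorization N D M →
      ∀ (X : ShimuraCurveData D M) (W : WeierstrassCurve ℚ) [W.IsElliptic] [W.IsGloballyMinimal],
        W.conductorNorm ℤ = N →
      ∀ (W' : WeierstrassCurve ℚ) [W'.IsElliptic] (P : ShimuraParametrizationData X W'),
        P.IsMinimalFor W → ∀ p : ℕ, p.Prime → p ∣ D →
        cJ P p ∣ (W'.minimalDiscriminantNorm ℤ).factorization p)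
    {S : Finset ℕ} (h2S : 2 ∈ S)
    (hEis : ∀ {N D M : ℕ}, IsAdmissibleFactorization N D M →
      ∀ (X : ShimuraCurveData D M) (W : WeierstrassCurve ℚ) [W.IsElliptic] [W.IsGloballyMinimal],
        W.conductorNorm ℤ = N →
      ∀ (W' : WeierstrassCurve ℚ) [W'.IsElliptic] (P : ShimuraParametrizationData X W'),
        P.IsMinimalFor W → ∀ p : ℕ, p.Prime → p ∣ M → ¬ p ^ 2 ∣ M →
        ∀ r : ℕ, r.Prime → ¬ r ∣ N → (cI P p : ℤ) ∣ (r + 1 : ℤ) - W'.LFunction r)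
    (h67 : ∀ ℓ : ℕ, ℓ.Prime → ∃ β : ℕ, (163 < ℓ → β = 1) ∧
      ∀ (A : WeierstrassCurve ℚ) [A.IsElliptic],
        (∀ q : ℕ, q.Prime → q ∉ S → ¬ q ^ 2 ∣ A.conductorNorm ℤ) →
        ∀ r₀ : ℕ, ∃ r : ℕ, r₀ < r ∧ r.Prime ∧ ¬ ((ℓ ^ β : ℕ) : ℤ) ∣ (r + 1 : ℤ) - A.LFunction r)
    (h610 : ∀ L : ℕ, 7 ≤ L → {Δ : ℕ | ∃ (W : WeierstrassCurve ℚ) (_ : W.IsElliptic),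
        (∀ q : ℕ, q.Prime → q ∉ S → ¬ q ^ 2 ∣ W.conductorNorm ℤ) ∧
        W.minimalDiscriminantNorm ℤ = Δ ∧
        ∃ n k : ℕ, (∀ q : ℕ, q.Prime → q ∣ n → q ∈ S) ∧ Δ = n * k ^ L}.Finite)
    (h611 : ∀ ℓ : ℕ, ℓ.Prime → 11 ≤ ℓ → ∀ (W : WeierstrassCurve ℚ) [W.IsElliptic],
      W.IsSemistable ℤ → ∀ k : ℕ, 2 ≤ k → W.minimalDiscriminantNorm ℤ ≠ k ^ ℓ)
    (h612 : ∀ (W : WeierstrassCurve ℚ) [W.IsElliptic], IsFreyHellegouarch W →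
      (∃ q : ℕ, q.Prime ∧ q ≠ 2 ∧ q ∣ W.conductorNorm ℤ) →
      ∀ ℓ : ℕ, ℓ.Prime → 3 ≤ ℓ → ∀ k : ℕ, ordCompl[2] (W.minimalDiscriminantNorm ℤ) ≠ k ^ ℓ) :
    PastenShimura2024_thm_6_1_b := by
  -- Lemma 6.14 from the Eisenstein property and Lemma 6.7; Lemma 6.8 from Mazur–Kenku
  obtain ⟨κ₁, hκ₁, hκ₁', h614⟩ := PastenShimura2024_lemma_6_14 cI hI hEis h67
  exact PastenShimura2024_thm_6_1_b_of_ribetTakahashi_inputs cI cJ hI hJ h613 hJc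
    (fun W W' _ _ hiso p hp hpN hp2 =>
      lemma_6_8_factorization_form (PastenShimura2024_lemma_6_8_of_mazurKenku' hMK) W W' hiso p hp
        hpN hp2)
    (Nat.one_le_iff_ne_zero.mp hκ₁ |> Nat.pos_of_ne_zero) h614 hP h0 hκ₁' h2S h610 h611 h612

/-! ## V. Second instalment: the semistable inputs from Mestre–Oesterlé (a fact of the tree)

For SEMISTABLE `E` the Diophantine inputs of Thm. 6.17 (i) — Lemma 6.11 (`ℓ ≥ 11`) and Lemma 6.10
(`S = ∅`, `L = ℓ³` for `ℓ ≤ 7`) — are both consequences of the tree's named fact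
`Literature.NumberTheory.EllipticCurves.mestreOesterle1989_thm_1` (Mestre–Oesterlé 1989, Thm. 1:
`|Δ_min(E)| = k^m`, `k ≥ 2`, `E` semistable ⟹ `m ≤ 5`): for every prime `ℓ`, `|Δ_min|` is neither
an `ℓ`-th power (`ℓ ≥ 7`) nor an `ℓ³`-th power (`ℓ³ ≥ 8`), so a semistable curve always has a
multiplicative prime `r` with `ℓ ∤ c_r(E)`, resp. `ℓ³ ∤ c_r(E)` — no exceptional curves occur. For
Frey–Hellegouarch `E`, Lemma 6.12 serves every `ℓ ≥ 3`, so Lemma 6.10 is needed only at `S ∋ 2`,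
`L = 8` (`ℓ = 2`). Thm. 6.17 is therefore re-proved in a "witness form" (per prime `ℓ`: a
multiplicative `r` with `ℓ ∤ c_r`, or, for `ℓ < 11`, one with `ℓ³ ∤ c_r` or membership of `|Δ_min|`
in a prescribed finite exceptional set), from which the fact follows with the Diophantine
hypotheses reduced to `mestreOesterle1989_thm_1` (tree), Lemma 6.12, and Lemma 6.10 at `L = 8`. -/

section RTSystemWitness

variable (cI cJ : ∀ {D M : ℕ} {X : ShimuraCurveData D M} {W' : WeierstrassCurve ℚ},
    ShimuraParametrizationData X W' → ℕ → ℕ)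
  (hI : ∀ {D M : ℕ} {X : ShimuraCurveData D M} {W' : WeierstrassCurve ℚ}
    (P : ShimuraParametrizationData X W') (p : ℕ), 0 < cI P p)
  (hJ : ∀ {D M : ℕ} {X : ShimuraCurveData D M} {W' : WeierstrassCurve ℚ}
    (P : ShimuraParametrizationData X W') (p : ℕ), 0 < cJ P p)
  (h613 : ∀ {N d M₁ D M p r : ℕ}, p.Prime → r.Prime → p ≠ r → D = d * (p * r) →
    M₁ = p * r * M → IsAdmissibleFactorization N D M →
    ∀ (X₁ : ShimuraCurveData d M₁) (X₂ : ShimuraCurveData D M)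
      (W : WeierstrassCurve ℚ) [W.IsElliptic] [W.IsGloballyMinimal], W.conductorNorm ℤ = N →
    ∀ (W₁' : WeierstrassCurve ℚ) [W₁'.IsElliptic] (P₁ : ShimuraParametrizationData X₁ W₁'),
      P₁.IsMinimalFor W →
    ∀ (W₂' : WeierstrassCurve ℚ) [W₂'.IsElliptic] (P₂ : ShimuraParametrizationData X₂ W₂'),
      P₂.IsMinimalFor W →
      P₁.deg * (cI P₁ p ^ 2 * cJ P₂ r ^ 2) =
        P₂.deg * ((W₁'.minimalDiscriminantNorm ℤ).factorization p *
          (W₂'.minimalDiscriminantNorm ℤ).factorization r))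
  (hJc : ∀ {N D M : ℕ}, IsAdmissibleFactorization N D M →
    ∀ (X : ShimuraCurveData D M) (W : WeierstrassCurve ℚ) [W.IsElliptic] [W.IsGloballyMinimal],
      W.conductorNorm ℤ = N →
    ∀ (W' : WeierstrassCurve ℚ) [W'.IsElliptic] (P : ShimuraParametrizationData X W'),
      P.IsMinimalFor W → ∀ p : ℕ, p.Prime → p ∣ D →
      cJ P p ∣ (W'.minimalDiscriminantNorm ℤ).factorization p)
  (h68 : ∀ (W W' : WeierstrassCurve ℚ) [W.IsElliptic] [W'.IsElliptic], W.IsIsogenous W' →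
    ∀ p : ℕ, p.Prime → p ∣ W.conductorNorm ℤ → ¬ p ^ 2 ∣ W.conductorNorm ℤ →
      ∃ a b : ℕ, 0 < a ∧ a ≤ 163 ∧ 0 < b ∧ b ≤ 163 ∧
        (W'.minimalDiscriminantNorm ℤ).factorization p * b =
          a * (W.minimalDiscriminantNorm ℤ).factorization p)
  {S : Finset ℕ} {κ₁ : ℕ} (hκ₁ : 0 < κ₁)
  (h614 : ∀ {N D M : ℕ}, IsAdmissibleFactorization N D M →
    ∀ (X : ShimuraCurveData D M) (W : WeierstrassCurve ℚ) [W.IsElliptic] [W.IsGloballyMinimal],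
      W.conductorNorm ℤ = N → (∀ q : ℕ, q.Prime → q ∉ S → ¬ q ^ 2 ∣ N) →
    ∀ (W' : WeierstrassCurve ℚ) [W'.IsElliptic] (P : ShimuraParametrizationData X W'),
      P.IsMinimalFor W → ∀ p : ℕ, p.Prime → p ∣ M → ¬ p ^ 2 ∣ M → cI P p ∣ κ₁)

include hI hJ h613 hJc h68 hκ₁ h614 in
/-- **Pasten 2024, Thm. 6.17 in witness form.** As `PastenShimura2024_thm_6_17'`, with the
Diophantine content of its proof isolated PER CURVE and PER PRIME `ℓ`, exactly as the printed proof
consumes it (p. 24: "If `ℓ ≥ 11` then Lemma 6.11 gives that there is some prime `r ∣ N` such that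
`ℓ ∤ c_r(E)`. On the other hand … if `ℓ ≤ 7` then there is some prime `r ∣ N` such that
`ℓ³ ∤ c_r(E)`, except, perhaps, for finitely many elliptic curves which can be discarded without
affecting the result. In either case, we choose such an `r ∣ N`"): for a prescribed family
`F : ℕ → Finset ℕ` of finite exceptional sets, every curve which at each prime `ℓ` has a
multiplicative prime `r` with `ℓ ∤ c_r(E)`, or — when `ℓ < 11` — one with `ℓ³ ∤ c_r(E)` or
`|Δ_min(E)| ∈ F(ℓ)`, satisfies `j_p(D,M) ∣ κ₂` (`p ∣ D`, `M` without exactly one multiplicative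
prime), with one `κ₂ ≥ 1` supported on primes `≤ 163` depending only on `S`, `κ_S` and `F`. Proof as
for `PastenShimura2024_thm_6_17'`: Lemma 6.15 / Lemma 6.16 on the witness, and for an exceptional
curve `v_ℓ(j_p) ≤ v_ℓ(c_p(A_{D,M})) ≤ log_ℓ 163 + v_ℓ(c_p(E)) ≤ log_ℓ 163 + max F(ℓ)`.
[cite: PastenShimura2024, Thm. 6.17 p. 24 (proof), with Lemmas 6.15–6.16 p. 24, Lemma 6.8 p. 22] -/
theorem PastenShimura2024_thm_6_17_of_witnesses (hP : nonempty_shimuraParametrizationData)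
    (hκ₁' : ∀ q ∈ κ₁.primeFactors, q ≤ 163) (F : ℕ → Finset ℕ) :
    ∃ κ₂ : ℕ, 1 ≤ κ₂ ∧ (∀ q ∈ κ₂.primeFactors, q ≤ 163) ∧
      ∀ {N D M : ℕ}, IsAdmissibleFactorization N D M →
      ∀ (X : ShimuraCurveData D M) (W : WeierstrassCurve ℚ) [W.IsElliptic] [W.IsGloballyMinimal],
        W.conductorNorm ℤ = N → (∀ q : ℕ, q.Prime → q ∉ S → ¬ q ^ 2 ∣ N) →
        (∀ ℓ : ℕ, ℓ.Prime →
          (∃ r : ℕ, r.Prime ∧ r ∣ N ∧ ¬ r ^ 2 ∣ N ∧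
            ¬ ℓ ∣ (W.minimalDiscriminantNorm ℤ).factorization r) ∨
          (ℓ < 11 ∧ ((∃ r : ℕ, r.Prime ∧ r ∣ N ∧ ¬ r ^ 2 ∣ N ∧
              ¬ ℓ ^ 3 ∣ (W.minimalDiscriminantNorm ℤ).factorization r) ∨
            W.minimalDiscriminantNorm ℤ ∈ F ℓ))) →
        (M.primeFactors.filter fun t => ¬ t ^ 2 ∣ N).card ≠ 1 →
      ∀ (W' : WeierstrassCurve ℚ) [W'.IsElliptic] (P : ShimuraParametrizationData X W'),
        P.IsMinimalFor W → ∀ p : ℕ, p.Prime → p ∣ D → cJ P p ∣ κ₂ := by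
  classical
  let α : ℕ → ℕ := fun ℓ =>
    2 * κ₁.factorization ℓ + 5 * Nat.log ℓ 163 + (if ℓ < 11 then 2 + (F ℓ).sup id else 0)
  have hα0 : ∀ ℓ : ℕ, ℓ.Prime → 164 ≤ ℓ → α ℓ = 0 := by
    intro ℓ hℓ h164
    have h1 : κ₁.factorization ℓ = 0 := by
      apply Finsupp.notMem_support_iff.mp
      rw [Nat.support_factorization]
      exact fun hmem => absurd (hκ₁' ℓ hmem) (by omega)
    have h2 : Nat.log ℓ 163 = 0 := Nat.log_of_lt (by omega)
    have h3 : ¬ ℓ < 11 := by omega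
    show 2 * κ₁.factorization ℓ + 5 * Nat.log ℓ 163 + (if ℓ < 11 then 2 + (F ℓ).sup id else 0) = 0
    rw [h1, h2, if_neg h3]
  refine ⟨∏ ℓ ∈ (Finset.range 164).filter Nat.Prime, ℓ ^ α ℓ,
    (one_le_prod_pow_and_primeFactors_lt 164 α).1,
    fun q hq => Nat.lt_succ_iff.mp ((one_le_prod_pow_and_primeFactors_lt 164 α).2 q hq), ?_⟩
  intro N D M hadm X W _ _ hWN hS hW hM1 W' _ P hPm p hp hpD
  refine dvd_prod_pow_of_factorization_le (hJ P p).ne' (fun ℓ hℓ => ?_) hα0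
  obtain ⟨hpN, hp2N⟩ := hadm.dvd_and_not_sq_dvd hp hpD
  -- Lemma 6.15 or Lemma 6.16 from a multiplicative witness prime `r`
  have main : ∀ r : ℕ, r.Prime → r ∣ N → ¬ r ^ 2 ∣ N →
      (cJ P p).factorization ℓ ≤
        ((W.minimalDiscriminantNorm ℤ).factorization r).factorization ℓ +
          2 * κ₁.factorization ℓ + 4 * Nat.log ℓ 163 := by
    intro r hr hrN hr2
    by_cases hrD : r ∣ D
    · have h15 := PastenShimura2024_lemma_6_15 cI cJ hI hJ h613 hJc h68 hκ₁ h614 hP hadm X W hWN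
        hS W' P hPm hp hr hpD hrD ℓ
      omega
    · have hrM : r ∣ M := hadm.dvd_right_of_not_dvd_left hr hrN hrD
      have hmem : r ∈ M.primeFactors.filter fun t => ¬ t ^ 2 ∣ N :=
        Finset.mem_filter.mpr ⟨Nat.mem_primeFactors.mpr ⟨hr, hrM, hadm.pos_right.ne'⟩, hr2⟩
      obtain ⟨t, ht⟩ : ((M.primeFactors.filter fun t => ¬ t ^ 2 ∣ N).erase r).Nonempty := by
        refine Finset.card_pos.mp ?_
        rw [Finset.card_erase_of_mem hmem]
        have : 0 < (M.primeFactors.filter fun t => ¬ t ^ 2 ∣ N).card :=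
          Finset.card_pos.mpr ⟨r, hmem⟩
        omega
      obtain ⟨htr, ht⟩ := Finset.mem_erase.mp ht
      obtain ⟨ht1, ht2⟩ := Finset.mem_filter.mp ht
      exact PastenShimura2024_lemma_6_16 cI cJ hI hJ h613 hJc h68 hκ₁ h614 hP hadm X W hWN hS W'
        P hPm hp hr hpD hrM hr2 ⟨t, Nat.prime_of_mem_primeFactors ht1,
          Nat.dvd_of_mem_primeFactors ht1, ht2, htr⟩ ℓ
  have hαge : 2 * κ₁.factorization ℓ + 5 * Nat.log ℓ 163 ≤ α ℓ := Nat.le_add_right _ _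
  rcases hW ℓ hℓ with ⟨r, hr, hrN, hr2, hndvd⟩ | ⟨hlt, hcase⟩
  · -- a witness with `v_ℓ(c_r(E)) = 0`
    have h0 : ((W.minimalDiscriminantNorm ℤ).factorization r).factorization ℓ = 0 :=
      Nat.factorization_eq_zero_of_not_dvd hndvd
    have h1 := main r hr hrN hr2
    omega
  · have hαeq : α ℓ = 2 * κ₁.factorization ℓ + 5 * Nat.log ℓ 163 + (2 + (F ℓ).sup id) := by
      show 2 * κ₁.factorization ℓ + 5 * Nat.log ℓ 163 + (if ℓ < 11 then 2 + (F ℓ).sup id else 0) = _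
      rw [if_pos hlt]
    rcases hcase with ⟨r, hr, hrN, hr2, hr3⟩ | hex
    · -- a witness with `v_ℓ(c_r(E)) ≤ 2`
      have hT : ((W.minimalDiscriminantNorm ℤ).factorization r).factorization ℓ ≤ 2 := by
        by_contra h3
        exact hr3 ((pow_dvd_pow ℓ (by omega)).trans (Nat.ordProj_dvd _ ℓ))
      have h1 := main r hr hrN hr2
      omega
    · -- an exceptional curve: `v_ℓ(j_p) ≤ v_ℓ(c_p(A_{D,M})) ≤ log_ℓ 163 + v_ℓ(c_p(E))`, bounded
      have hΔ0 : W.minimalDiscriminantNorm ℤ ≠ 0 := (W.minimalDiscriminantNorm_pos_holds).ne'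
      rw [← hWN] at hpN hp2N
      obtain ⟨a, b, ha, ha', hb, hb', e⟩ := h68 W W' hPm.1 p hp hpN hp2N
      have hcpE := factorization_minimalDiscriminantNorm_pos_of_dvd W hp hpN
      have h1 := factorization_le_of_dvd_of_mul_eq_mul (hJc hadm X W hWN W' P hPm p hp hpD)
        ha ha' hb hb' hcpE e ℓ
      have h2 : ((W.minimalDiscriminantNorm ℤ).factorization p).factorization ℓ ≤ (F ℓ).sup id :=
        calc ((W.minimalDiscriminantNorm ℤ).factorization p).factorization ℓ
            ≤ (W.minimalDiscriminantNorm ℤ).factorization p := (Nat.factorization_lt ℓ hcpE.ne').le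
          _ ≤ W.minimalDiscriminantNorm ℤ := (Nat.factorization_lt p hΔ0).le
          _ ≤ (F ℓ).sup id := Finset.le_sup (f := id) hex
      omega

include hI hJ h613 hJc h68 hκ₁ h614 in
/-- **Pasten 2024, Thm. 6.1 (b) with the semistable Diophantine inputs taken from the tree's fact
`mestreOesterle1989_thm_1`.** As `PastenShimura2024_thm_6_1_b_of_ribetTakahashi_inputs`, but: in
class (b.1) the witness primes of Thm. 6.17 come, for EVERY prime `ℓ`, from Mestre–Oesterlé's
Thm. 1 (`hMO`, a named fact of the tree: `|Δ_min| = k^m`, `k ≥ 2`, `E` semistable ⟹ `m ≤ 5`; so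
`|Δ_min|` is not an `ℓ`-th power for `ℓ ≥ 7` — which contains Lemma 6.11 — nor an `ℓ³`-th power,
`ℓ³ ≥ 8` — which makes Lemma 6.10 at `S = ∅` unnecessary: no exceptional semistable curve exists);
in class (b.2) they come from Lemma 6.12 (`h612`) for every `ℓ ≥ 3`, and at `ℓ = 2` from Lemma 6.10
with `S ∋ 2`, `L = 8` (`h610`: finitely many `|Δ_min|` among the curves semistable away from `S`
with `|Δ_min| = n · k⁸`, `n` supported on `S`; Darmon–Granville), exactly as printed ("we apply
Lemma 6.12 instead of Lemma 6.11, and then we apply Lemma 6.10 using the finite set of primes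
`S = {2}`"). So the Diophantine trust base is `mestreOesterle1989_thm_1` (tree), Lemma 6.12, and
Lemma 6.10 at `L = 8`.
[cite: PastenShimura2024, Thm. 6.1 (b) p. 20, Thm. 6.17 p. 24 (proof, cases (i)/(ii)), Lemmas 6.10–6.12 p. 23] [cite: MestreOesterle1989, §4 Théorème 1 (p. 176)] -/
theorem PastenShimura2024_thm_6_1_b_of_ribetTakahashi_mestreOesterle
    (hMO : mestreOesterle1989_thm_1) (hP : nonempty_shimuraParametrizationData)
    (h0 : ∀ {N : ℕ} [NeZero N] (X : ShimuraCurveData 1 N) (W : WeierstrassCurve ℚ) [W.IsElliptic]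
      [W.IsGloballyMinimal], W.conductorNorm ℤ = N →
      (W.IsSemistable ℤ ∧ ¬ N.Prime) ∨
        (IsFreyHellegouarch W ∧ 2 ≤ (N.primeFactors.erase 2).card) →
      ∀ (W₁ : WeierstrassCurve ℚ) [W₁.IsElliptic] (D₁ : ModularParametrizationData W₁ N),
        IsNewformOf W D₁.f →
        (∀ (W₂ : WeierstrassCurve ℚ) [W₂.IsElliptic] (D₂ : ModularParametrizationData W₂ N),
            D₂.f = D₁.f → D₁.modularDegree ≤ D₂.modularDegree) →
      ∀ (W' : WeierstrassCurve ℚ) [W'.IsElliptic] (P : ShimuraParametrizationData X W'),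
        P.IsMinimalFor W → P.deg ∣ D₁.modularDegree)
    (hκ₁' : ∀ q ∈ κ₁.primeFactors, q ≤ 163) (h2S : 2 ∈ S)
    (h612 : ∀ (W : WeierstrassCurve ℚ) [W.IsElliptic], IsFreyHellegouarch W →
      (∃ q : ℕ, q.Prime ∧ q ≠ 2 ∧ q ∣ W.conductorNorm ℤ) →
      ∀ ℓ : ℕ, ℓ.Prime → 3 ≤ ℓ → ∀ k : ℕ, ordCompl[2] (W.minimalDiscriminantNorm ℤ) ≠ k ^ ℓ)
    (h610 : {Δ : ℕ | ∃ (W : WeierstrassCurve ℚ) (_ : W.IsElliptic),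
        (∀ q : ℕ, q.Prime → q ∉ S → ¬ q ^ 2 ∣ W.conductorNorm ℤ) ∧
        W.minimalDiscriminantNorm ℤ = Δ ∧
        ∃ n k : ℕ, (∀ q : ℕ, q.Prime → q ∣ n → q ∈ S) ∧ Δ = n * k ^ 8}.Finite) :
    PastenShimura2024_thm_6_1_b := by
  classical
  -- the exceptional family: Lemma 6.10 at `L = 8` for `ℓ = 2`, nothing elsewhere
  obtain ⟨κ₂, hκ₂, hκ₂', h617⟩ := PastenShimura2024_thm_6_17_of_witnesses cI cJ hI hJ h613 hJc h68
    hκ₁ h614 hP hκ₁' (fun ℓ => if ℓ = 2 then h610.toFinset else ∅)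
  refine PastenShimura2024_thm_6_1_b_of_prop_6_13_bounded_of_lemma_6_8
    nonempty_shimuraCurveData_holds hP h0 (Nat.one_le_iff_ne_zero.mpr hκ₁.ne') hκ₂ hκ₁' hκ₂' ?_ h68
  intro N D M d p r hp hr hpr hD hadm X₁ X₂ W _ _ hWN hcl W₁' _ P₁ hP₁ W₂' _ P₂ hP₂
  -- both classes are semistable away from `S ∋ 2`
  have hS : ∀ q : ℕ, q.Prime → q ∉ S → ¬ q ^ 2 ∣ N := by
    intro q hq hqS
    have hq2 : q ≠ 2 := fun h => hqS (h ▸ h2S)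
    rw [← hWN]
    rcases hcl with ⟨hss, -⟩ | ⟨hFH, -⟩
    · exact not_sq_dvd_conductorNorm_of_isSemistable W hss hq
    · exact not_sq_dvd_conductorNorm_of_isFreyHellegouarch hFH hq hq2
  -- `i_p(d,prM) ∣ κ_S` (Lemma 6.14 at the admissible level `(d, prM)`, `p ∥ prM`)
  have hpD : p ∣ D := ⟨d * r, by rw [hD]; ring⟩
  have hrD : r ∣ D := ⟨d * p, by rw [hD]; ring⟩
  obtain ⟨-, hadm₁, -, -⟩ := hadm.erase_two_primes hp hr hpr hpD hrD
  have hd : D / (p * r) = d := by rw [hD, Nat.mul_div_cancel _ (Nat.mul_pos hp.pos hr.pos)]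
  rw [hd] at hadm₁
  obtain ⟨-, hp1, hp2⟩ := hadm.not_sq_dvd_mul_of_dvd hp hr hpr hpD
  have hiκ : cI P₁ p ∣ κ₁ := h614 hadm₁ X₁ W hWN hS W₁' P₁ hP₁ p hp hp1 hp2
  have hN1 : N ≠ 1 := fun h1 =>
    hp.one_lt.ne' (Nat.dvd_one.mp (h1 ▸ (hadm.dvd_and_not_sq_dvd hp hpD).1))
  have hN1' : W.conductorNorm ℤ ≠ 1 := hWN.symm ▸ hN1
  -- the witnesses, prime by prime, in the two classes
  have hW : ∀ ℓ : ℕ, ℓ.Prime →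
      (∃ r : ℕ, r.Prime ∧ r ∣ N ∧ ¬ r ^ 2 ∣ N ∧
        ¬ ℓ ∣ (W.minimalDiscriminantNorm ℤ).factorization r) ∨
      (ℓ < 11 ∧ ((∃ r : ℕ, r.Prime ∧ r ∣ N ∧ ¬ r ^ 2 ∣ N ∧
          ¬ ℓ ^ 3 ∣ (W.minimalDiscriminantNorm ℤ).factorization r) ∨
        W.minimalDiscriminantNorm ℤ ∈ (if ℓ = 2 then h610.toFinset else ∅))) := by
    intro ℓ hℓ
    rcases hcl with ⟨hss, -⟩ | ⟨hFH, hM2⟩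
    · -- (b.1): Mestre–Oesterlé, `|Δ_min| ≠ k^ℓ` (`ℓ ≥ 7`) and `|Δ_min| ≠ k^{ℓ³}` (`ℓ³ ≥ 8`)
      by_cases h7 : 7 ≤ ℓ
      · left
        rw [← hWN]
        exact fermatInput_of_isSemistable W hss hN1'
          (fun k hk hΔ => absurd (hMO W hss ℓ k hk hΔ) (by omega))
      · right
        refine ⟨by omega, Or.inl ?_⟩
        rw [← hWN]
        have h8 : 8 ≤ ℓ ^ 3 :=
          calc 8 = 2 ^ 3 := by norm_num
            _ ≤ ℓ ^ 3 := Nat.pow_le_pow_left hℓ.two_le 3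
        exact fermatInput_of_isSemistable W hss hN1'
          (fun k hk hΔ => absurd (hMO W hss (ℓ ^ 3) k hk hΔ) (by omega))
    · -- (b.2): Lemma 6.12 for `ℓ ≥ 3`, Lemma 6.10 (`S ∋ 2`, `L = 8`) at `ℓ = 2`
      by_cases h3 : 3 ≤ ℓ
      · left
        rw [← hWN]
        have hodd : ∃ q : ℕ, q.Prime ∧ q ≠ 2 ∧ q ∣ W.conductorNorm ℤ := by
          obtain ⟨q, hq⟩ : (M.primeFactors.erase 2).Nonempty := Finset.card_pos.mp (by omega)
          obtain ⟨hq2, hq⟩ := Finset.mem_erase.mp hq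
          refine ⟨q, Nat.prime_of_mem_primeFactors hq, hq2, ?_⟩
          rw [hWN, ← hadm.mul_eq]
          exact Dvd.dvd.mul_left (Nat.dvd_of_mem_primeFactors hq) D
        exact fermatInput_of_isFreyHellegouarch W hFH (h612 W hFH hodd ℓ hℓ h3)
      · have hℓ2 : ℓ = 2 := by have := hℓ.two_le; omega
        subst hℓ2
        refine Or.inr ⟨by norm_num, ?_⟩
        have hΔ0 : W.minimalDiscriminantNorm ℤ ≠ 0 := (W.minimalDiscriminantNorm_pos_holds).ne'
        by_cases hex : W.minimalDiscriminantNorm ℤ ∈ {Δ : ℕ | ∃ (W : WeierstrassCurve ℚ)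
            (_ : W.IsElliptic), (∀ q : ℕ, q.Prime → q ∉ S → ¬ q ^ 2 ∣ W.conductorNorm ℤ) ∧
            W.minimalDiscriminantNorm ℤ = Δ ∧
            ∃ n k : ℕ, (∀ q : ℕ, q.Prime → q ∣ n → q ∈ S) ∧ Δ = n * k ^ 8}
        · right
          rw [if_pos rfl]
          exact h610.mem_toFinset.mpr hex
        · left
          obtain ⟨r, hr, hrS, hr3⟩ : ∃ r : ℕ, r.Prime ∧ r ∉ S ∧
              ¬ 8 ∣ (W.minimalDiscriminantNorm ℤ).factorization r := by
            by_contra hcon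
            push Not at hcon
            obtain ⟨n, k, -, hnS, hnk⟩ := exists_eq_mul_pow_of_dvd_factorization S hΔ0 hcon
            exact hex ⟨W, ‹W.IsElliptic›, fun q hq hqS => by rw [hWN]; exact hS q hq hqS, rfl,
              n, k, hnS, hnk⟩
          have hcr0 : (W.minimalDiscriminantNorm ℤ).factorization r ≠ 0 := fun h0 =>
            hr3 (h0 ▸ dvd_zero _)
          exact ⟨r, hr, hWN ▸ dvd_conductorNorm_of_factorization_ne_zero W hcr0, hS r hr hrS,
            by norm_num; exact hr3⟩
  -- the condition on `M`, in the two classes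
  have hM1 : (M.primeFactors.filter fun t => ¬ t ^ 2 ∣ N).card ≠ 1 := by
    rcases hcl with ⟨hss, hMp⟩ | ⟨hFH, hM2⟩
    · have hfilt : (M.primeFactors.filter fun t => ¬ t ^ 2 ∣ N) = M.primeFactors :=
        Finset.filter_true_of_mem fun t ht => by
          rw [← hWN]
          exact not_sq_dvd_conductorNorm_of_isSemistable W hss (Nat.prime_of_mem_primeFactors ht)
      rw [hfilt]
      intro h1
      obtain ⟨t, ht⟩ := Finset.card_eq_one.mp h1
      have hsqN : Squarefree N := hWN ▸ (W.isSemistable_iff_squarefree_conductorNorm).mp hss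
      have hsqM : Squarefree M :=
        Squarefree.squarefree_of_dvd ⟨D, by rw [← hadm.mul_eq, mul_comm]⟩ hsqN
      have hM : M = t := by
        rw [← Nat.prod_primeFactors_of_squarefree hsqM, ht, Finset.prod_singleton]
      have htp : t.Prime := Nat.prime_of_mem_primeFactors (ht ▸ Finset.mem_singleton_self t)
      exact hMp (hM ▸ htp)
    · have hsub : M.primeFactors.erase 2 ⊆ M.primeFactors.filter fun t => ¬ t ^ 2 ∣ N := by
        intro t ht
        obtain ⟨ht2, ht⟩ := Finset.mem_erase.mp ht
        refine Finset.mem_filter.mpr ⟨ht, ?_⟩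
        rw [← hWN]
        exact not_sq_dvd_conductorNorm_of_isFreyHellegouarch hFH (Nat.prime_of_mem_primeFactors ht) ht2
      have := Finset.card_le_card hsub
      omega
  exact ⟨cI P₁ p, cJ P₂ r, hI P₁ p, hJ P₂ r, hiκ, h617 hadm X₂ W hWN hS hW hM1 W₂' P₂ hP₂ r hr hrD,
    h613 hp hr hpr hD rfl hadm X₁ X₂ W hWN W₁' P₁ hP₁ W₂' P₂ hP₂⟩

end RTSystemWitness

/-- **Pasten 2024, Thm. 6.1 (b) over the tree's facts — the trust base after this file.** From the
tree's named facts `mazurKenku_exists_cyclic_isogeny` (Lemma 6.8), `mestreOesterle1989_thm_1`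
(the semistable Diophantine input, containing Lemma 6.11 and replacing Lemma 6.10 at `S = ∅`) and
`nonempty_shimuraParametrizationData` (Jacquet–Langlands), Thm. 6.1 (b) follows from exactly these
statements without a declaration in the tree: the component-group data `cI`, `cJ` (orders of the
image and cokernel of `q_{D,M,p,*}`, §6.6) with (`h613`) Ribet–Takahashi 1997 Thm. 2 = Prop. 6.13,
(`hEis`) the Eisenstein divisibility `i_p(D,M) ∣ r + 1 − a_r(A_{D,M})` (Ribet; proof of Lemma 6.14),
(`h67`) Lemma 6.7 (Mazur, Ribet, Faltings, Chebotarev), (`hJc`) `j_p(D,M) ∣ #Φ_p(A_{D,M})`;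
(`h612`) Lemma 6.12 (Wiles, Ribet 1997, Darmon–Merel); (`h610`) Lemma 6.10 at `S ∋ 2`, `L = 8`
(Darmon–Granville); and (`h0`) the `D = 1` bridge of the two renderings of `δ_{1,N}`. Lemma 6.14,
Lemmas 6.15–6.16, Thm. 6.17 and the telescoping of §6.9 are theorems of the tree.
[cite: PastenShimura2024, Thm. 6.1 (b) p. 20, §6.3–6.9 pp. 21–25] [cite: RibetTakahashi1997, Thm. 2] [cite: MestreOesterle1989, §4 Théorème 1] [cite: Mazur1978, Thm. 1] [cite: Kenku1982] -/
theorem PastenShimura2024_thm_6_1_b_of_ribetTakahashi_treeFacts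
    (hMK : mazurKenku_exists_cyclic_isogeny) (hMO : mestreOesterle1989_thm_1)
    (hP : nonempty_shimuraParametrizationData)
    (h0 : ∀ {N : ℕ} [NeZero N] (X : ShimuraCurveData 1 N) (W : WeierstrassCurve ℚ) [W.IsElliptic]
      [W.IsGloballyMinimal], W.conductorNorm ℤ = N →
      (W.IsSemistable ℤ ∧ ¬ N.Prime) ∨
        (IsFreyHellegouarch W ∧ 2 ≤ (N.primeFactors.erase 2).card) →
      ∀ (W₁ : WeierstrassCurve ℚ) [W₁.IsElliptic] (D₁ : ModularParametrizationData W₁ N),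
        IsNewformOf W D₁.f →
        (∀ (W₂ : WeierstrassCurve ℚ) [W₂.IsElliptic] (D₂ : ModularParametrizationData W₂ N),
            D₂.f = D₁.f → D₁.modularDegree ≤ D₂.modularDegree) →
      ∀ (W' : WeierstrassCurve ℚ) [W'.IsElliptic] (P : ShimuraParametrizationData X W'),
        P.IsMinimalFor W → P.deg ∣ D₁.modularDegree)
    (cI cJ : ∀ {D M : ℕ} {X : ShimuraCurveData D M} {W' : WeierstrassCurve ℚ},
      ShimuraParametrizationData X W' → ℕ → ℕ)
    (hI : ∀ {D M : ℕ} {X : ShimuraCurveData D M} {W' : WeierstrassCurve ℚ}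
      (P : ShimuraParametrizationData X W') (p : ℕ), 0 < cI P p)
    (hJ : ∀ {D M : ℕ} {X : ShimuraCurveData D M} {W' : WeierstrassCurve ℚ}
      (P : ShimuraParametrizationData X W') (p : ℕ), 0 < cJ P p)
    (h613 : ∀ {N d M₁ D M p r : ℕ}, p.Prime → r.Prime → p ≠ r → D = d * (p * r) →
      M₁ = p * r * M → IsAdmissibleFactorization N D M →
      ∀ (X₁ : ShimuraCurveData d M₁) (X₂ : ShimuraCurveData D M)
        (W : WeierstrassCurve ℚ) [W.IsElliptic] [W.IsGloballyMinimal], W.conductorNorm ℤ = N →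
      ∀ (W₁' : WeierstrassCurve ℚ) [W₁'.IsElliptic] (P₁ : ShimuraParametrizationData X₁ W₁'),
        P₁.IsMinimalFor W →
      ∀ (W₂' : WeierstrassCurve ℚ) [W₂'.IsElliptic] (P₂ : ShimuraParametrizationData X₂ W₂'),
        P₂.IsMinimalFor W →
        P₁.deg * (cI P₁ p ^ 2 * cJ P₂ r ^ 2) =
          P₂.deg * ((W₁'.minimalDiscriminantNorm ℤ).factorization p *
            (W₂'.minimalDiscriminantNorm ℤ).factorization r))
    (hJc : ∀ {N D M : ℕ}, IsAdmissibleFactorization N D M →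
      ∀ (X : ShimuraCurveData D M) (W : WeierstrassCurve ℚ) [W.IsElliptic] [W.IsGloballyMinimal],
        W.conductorNorm ℤ = N →
      ∀ (W' : WeierstrassCurve ℚ) [W'.IsElliptic] (P : ShimuraParametrizationData X W'),
        P.IsMinimalFor W → ∀ p : ℕ, p.Prime → p ∣ D →
        cJ P p ∣ (W'.minimalDiscriminantNorm ℤ).factorization p)
    {S : Finset ℕ} (h2S : 2 ∈ S)
    (hEis : ∀ {N D M : ℕ}, IsAdmissibleFactorization N D M →
      ∀ (X : ShimuraCurveData D M) (W : WeierstrassCurve ℚ) [W.IsElliptic] [W.IsGloballyMinimal],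
        W.conductorNorm ℤ = N →
      ∀ (W' : WeierstrassCurve ℚ) [W'.IsElliptic] (P : ShimuraParametrizationData X W'),
        P.IsMinimalFor W → ∀ p : ℕ, p.Prime → p ∣ M → ¬ p ^ 2 ∣ M →
        ∀ r : ℕ, r.Prime → ¬ r ∣ N → (cI P p : ℤ) ∣ (r + 1 : ℤ) - W'.LFunction r)
    (h67 : ∀ ℓ : ℕ, ℓ.Prime → ∃ β : ℕ, (163 < ℓ → β = 1) ∧
      ∀ (A : WeierstrassCurve ℚ) [A.IsElliptic],
        (∀ q : ℕ, q.Prime → q ∉ S → ¬ q ^ 2 ∣ A.conductorNorm ℤ) →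
        ∀ r₀ : ℕ, ∃ r : ℕ, r₀ < r ∧ r.Prime ∧ ¬ ((ℓ ^ β : ℕ) : ℤ) ∣ (r + 1 : ℤ) - A.LFunction r)
    (h612 : ∀ (W : WeierstrassCurve ℚ) [W.IsElliptic], IsFreyHellegouarch W →
      (∃ q : ℕ, q.Prime ∧ q ≠ 2 ∧ q ∣ W.conductorNorm ℤ) →
      ∀ ℓ : ℕ, ℓ.Prime → 3 ≤ ℓ → ∀ k : ℕ, ordCompl[2] (W.minimalDiscriminantNorm ℤ) ≠ k ^ ℓ)
    (h610 : {Δ : ℕ | ∃ (W : WeierstrassCurve ℚ) (_ : W.IsElliptic),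
        (∀ q : ℕ, q.Prime → q ∉ S → ¬ q ^ 2 ∣ W.conductorNorm ℤ) ∧
        W.minimalDiscriminantNorm ℤ = Δ ∧
        ∃ n k : ℕ, (∀ q : ℕ, q.Prime → q ∣ n → q ∈ S) ∧ Δ = n * k ^ 8}.Finite) :
    PastenShimura2024_thm_6_1_b := by
  obtain ⟨κ₁, hκ₁, hκ₁', h614⟩ := PastenShimura2024_lemma_6_14 cI hI hEis h67
  exact PastenShimura2024_thm_6_1_b_of_ribetTakahashi_mestreOesterle cI cJ hI hJ h613 hJc
    (fun W W' _ _ hiso p hp hpN hp2 =>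
      lemma_6_8_factorization_form (PastenShimura2024_lemma_6_8_of_mazurKenku' hMK) W W' hiso p hp
        hpN hp2)
    (Nat.one_le_iff_ne_zero.mp hκ₁ |> Nat.pos_of_ne_zero) h614 hMO hP h0 hκ₁' h2S h612 h610

end Literature.NumberTheory.Automorphic

end
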